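import Summits.KontsevichZagierPeriods.KontsevichZagierPeriods.Theses.FurushoPentagon
import Literature.NumberTheory.Transcendental.KZKernelConjectureForms
import Literature.NumberTheory.Transcendental.KZRulesAssociator
import Literature.NumberTheory.Transcendental.KZLogCalculusProofs
import Literature.NumberTheory.Transcendental.KZSubcalculusInvariants
import Literature.NumberTheory.Transcendental.KZVolumeConjectureProofs

/-!
# Disproof of `ReducedPeriodRing` (crux stmt-KontsevichZagierPeriods-3929) — findings

Crux (route FurushoPentagon, rank 3): `∀ c : KZ.FormalRep, c * c ∈ KZ.relations → c ∈ KZ.relations`,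
i.e. the formal period ring `P = FormalRep ⧸ relations` of the Kontsevich–Zagier rules calculus has
no nilpotents. Standing-adversary file (cdisprove; gen 2 wrote §§1–9, gen 3 = cycle 2 adds §1c,
§8b, §9b, §10). VERDICT SO FAR: **not killed; every cheap door is closed, and a kill would be
`¬ KontsevichZagierPeriods`** (`not_summit_of_not_reducedPeriodRing`); cycle 2 locates the crux as
EXACTLY the reducedness half of Conjecture 1 = (irreducibility `ker evalP ⊆ nil P`) ∧ (reducedness),
the two halves abstractly independent. Everything below is `sorry`-free. LANDED in the tree
(importable; namespace `Summit.KontsevichZagierPeriods.KontsevichZagierPeriods.ReducedPeriodRingNegative`):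
`Theorems/ReducedPeriodRing/Negative/LoadBearing.lean` (p69616), `…/RingForms.lean` (p69836),
`…/PositiveCone.lean` (p69908), `…/DimZero.lean` (p69934), `…/Certificates.lean` (p70154),
`…/ModelsAnatomy.lean` (p70441); cycle 2: `…/SpecHalves.lean`, `…/WitnessPairs.lean`,
`…/LineLoadBearing.lean` (proposal ids in the item's evidence notes). `IntegerDivision` (item 3934)
is PROVED (§6b, candidate attached there).

* §1 Logical position — crux ⇔ `IsReduced KZ.FormalPeriodRing` ⇔ `nilradical P = ⊥` ⇔
  `⋂ primes = ⊥` (the form `FurushoOverReduced` consumes); kernel conjecture ⇔ `Injective evalP`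
  ⇒ `IsDomain P` ⇒ crux; summit ⇒ crux.
* §2 Load-bearing — the one hypothesis cannot be dropped (`[pt,1] ∉ relations`) and weakening it to
  `eval c = 0` is VERBATIM the summit: a proof must use the square, not its value.
* §3 Strengthenings — on-the-nose reducedness of `FormalRep` is false (`[∅]`); iterated-square and
  `xⁿ = 0` forms are equivalent to the crux; `route_usage`: what Furusho's transfer actually needs.
* §4 Positive fragments — null domains / a.e.-zero integrands are relations; the kernel conjecture
  holds on the POSITIVE CONE, so ±cone carries no nilpotent; §4b every `c` is `P − Q` with `P, Q` in
  the cone, hence crux ⇔ AM–GM rigidity `P² + Q² ∼ PQ + QP ⇒ P ∼ Q` on the cone.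
* §5 Independence — over the abstract interface (comm. ring + evaluation character) reducedness is
  undecided (dual numbers vs `ℝ`); square-root gaps / cancellation failures (route Neg, Das 2000,
  `PiCancellation`) are zero-divisors in a REDUCED model `ℚ[ℤ/2]`: they can never refute this crux.
* §6 Certificates — `¬crux` ⇔ an additive move-invariant `φ` with `φ c ≠ 0`, `c² ∈ relations`;
  `φ` cannot factor through `eval`, cannot be multiplicative into a reduced ring (kills every
  realisation character `χ`), cannot have bounded-exponent values (`P` is DIVISIBLE:
  `[σ,f] ∼ N•[σ,f/N]`); with `IntegerDivision`, `P` is a `ℚ`-vector space.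
* §6b/§6c By-products — every `N ≥ 1` is a unit of `P`, so `IntegerDivision` (item 3934) HOLDS
  (`integerDivision_holds`), `P` is uniquely divisible of characteristic 0, `P → P_ℚ` is a ring
  isomorphism (`toPeriodAlgebra_bijective`) and `IsReduced P_ℚ ↔ crux`
  (`isReduced_formalPeriodAlgebra_iff`): Furusho's lever can be run over `P_ℚ ≅ P` directly.
* §7 Dimension 0 — the constants satisfy the kernel conjecture; no nilpotent there.
* §8 Anatomy of a witness — the only door is a COMMON SQUARE one Fubini level up, reachable only
  through coordinate-mixing substitutions (BCK/polar type) with no fibrewise shadow; worked π/2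
  example closes; Γ-monomial gaps, `[π]`-cancellation, MZV defects are non-candidates (why);
  `¬crux` ⇔ a pair `r ≁ r'` with `([r]−[r'])² ∈ relations` ⇔ ONE representation `u` with
  `[u ⊠ u] ∈ relations`, `[u] ∉ relations` — and such `u` must change sign (`witness_changes_sign`).
* §9 Lines on record — the Cartier-pullback card's `C⁺ := NilpotentsArePiTorsion`: implied by
  PiLocalKernel, gives the crux with PiCancellation, carries no reducedness alone (model).
* §1c (cycle 2) Spec halves — `KZKernelConjecture ↔ KernelIsNil ∧ crux`; `KernelIsNil` ⇔
  `nil P = ker evalP` ⇔ every prime ⊇ `ker evalP` ⇔ field-valued realisations factor through the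
  VALUE; crux ⇔ they separate; models both ways; idempotents are invisible to the crux.
* §8b (cycle 2) Witness = a NON-NEGATIVE PAIR `a, b` (same dimension, equal value) with a move
  chain for `a⊠a + b⊠b ∼ a⊠b + b⊠a` and none for `a ∼ b`; crux ⇔ that rigidity; VOLUME FORM: two
  compact semialgebraic bodies with `vol(A²)+vol(B²) = 2vol(A×B)` provable, `vol A = vol B` not.
* §9b (cycle 2) The PICKED line (skeleton c5e5bca5…, 7 stubs) as commutative algebra: transfer
  valid, each of its four inputs load-bearing (drop-one models), conjectural weight on 0540 only.
* §1d (cycle 2) Lattice across routes: `KernelIsNil ∧ C⁺ ⇒ PiLocalKernel` (0541); the two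
  routes' seams and `C⁺` as common currency.
* §10 Targets: payload targets empty; stub-by-stub adversary notes and first attacks queued.
* §11 For the provers: the proved reformulations and what a proof must do (square-root
  extraction on move chains; the three sound extraction procedures and where they stop).
-/

noncomputable section

set_option linter.dupNamespace false

namespace Summit.KontsevichZagierPeriods.KontsevichZagierPeriods.Cruxes.ReducedPeriodRing.Disproof

open Literature.NumberTheory.Transcendental
open Literature.NumberTheory.Transcendental.KZ
open Summit.KontsevichZagierPeriods.KontsevichZagierPeriods.Theses.FurushoPentagon

/-! ## §1 Logical position of the crux -/

/-- A square that is a relation evaluates to `0`, hence so does its root: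
`eval (c * c) = (eval c)²` (Fubini, `KZ.eval_mul'`) and soundness `KZ.relations_le_ker_eval_holds`.
Every counterexample to the crux therefore lies in `ker eval`. [folklore] -/
theorem eval_eq_zero_of_sq_mem_relations {c : FormalRep} (h : c * c ∈ relations) : eval c = 0 := by
  have h0 : eval (c * c) = 0 := relations_le_ker_eval_holds h
  rw [eval_mul'] at h0
  exact mul_self_eq_zero.mp h0

/-- The kernel form of Conjecture 1 implies the crux. [folklore] -/
theorem reducedPeriodRing_of_kernel (hK : KZKernelConjecture) : ReducedPeriodRing :=
  fun c hc => hK c (eval_eq_zero_of_sq_mem_relations hc)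

/-- The summit implies the crux (through `kzKernelConjecture_iff_isRational`). [folklore] -/
theorem reducedPeriodRing_of_summit (h : KontsevichZagierPeriods) : ReducedPeriodRing :=
  reducedPeriodRing_of_kernel (kzKernelConjecture_iff_isRational.mpr (KontsevichZagierPeriods_iff.mp h))

/-- **A kill of this crux is a kill of the summit.** [folklore] -/
theorem not_summit_of_not_reducedPeriodRing (h : ¬ ReducedPeriodRing) : ¬ KontsevichZagierPeriods :=
  fun hs => h (reducedPeriodRing_of_summit hs)

/-! ### Ring-theoretic reformulations over `P = KZ.FormalPeriodRing = FormalRep ⧸ relations` -/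

/-- The crux IS reducedness of the formal period ring `P`. [folklore] -/
theorem reducedPeriodRing_iff_isReduced : ReducedPeriodRing ↔ IsReduced FormalPeriodRing := by
  rw [isReduced_iff_pow_one_lt 2 one_lt_two]
  constructor
  · intro h x hx
    obtain ⟨c, rfl⟩ := toFormalPeriod_surjective x
    rw [pow_two, ← map_mul, toFormalPeriod_eq_zero_iff] at hx
    exact toFormalPeriod_eq_zero_iff.mpr (h c hx)
  · intro h c hc
    have h1 : toFormalPeriod c ^ 2 = 0 := by
      rw [pow_two, ← map_mul, toFormalPeriod_eq_zero_iff]; exact hc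
    exact toFormalPeriod_eq_zero_iff.mp (h _ h1)

/-- A counterexample to the crux is exactly a non-zero square-zero formal period. [folklore] -/
theorem not_reducedPeriodRing_iff_exists_sq_zero :
    ¬ ReducedPeriodRing ↔ ∃ x : FormalPeriodRing, x ≠ 0 ∧ x ^ 2 = 0 := by
  rw [reducedPeriodRing_iff_isReduced, isReduced_iff_pow_one_lt 2 one_lt_two]
  push Not
  exact ⟨fun ⟨x, hx, hx0⟩ => ⟨x, hx0, hx⟩, fun ⟨x, hx0, hx⟩ => ⟨x, hx, hx0⟩⟩

/-- The crux says the nilradical of `P` vanishes … [folklore] -/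
theorem reducedPeriodRing_iff_nilradical_eq_bot :
    ReducedPeriodRing ↔ nilradical FormalPeriodRing = ⊥ := by
  rw [nilradical_eq_bot_iff, reducedPeriodRing_iff_isReduced]

/-- … i.e. the prime ideals of `P` have zero intersection: `P ↪ ∏_𝔭 P/𝔭` — the form in which the
route's lever `FurushoOverReduced` consumes it. [folklore] -/
theorem reducedPeriodRing_iff_sInf_primes_eq_bot :
    ReducedPeriodRing ↔ sInf {J : Ideal FormalPeriodRing | J.IsPrime} = ⊥ := by
  rw [reducedPeriodRing_iff_nilradical_eq_bot, nilradical_eq_sInf]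

/-- The kernel conjecture IS injectivity of `evalP : P →+* ℝ`. [folklore] -/
theorem kzKernelConjecture_iff_injective_evalP :
    KZKernelConjecture ↔ Function.Injective evalP := by
  rw [injective_iff_map_eq_zero]
  constructor
  · intro h x hx
    obtain ⟨c, rfl⟩ := toFormalPeriod_surjective x
    rw [evalP_toFormalPeriod] at hx
    exact toFormalPeriod_eq_zero_iff.mpr (h c hx)
  · intro h c hc
    exact toFormalPeriod_eq_zero_iff.mp (h _ (by rwa [evalP_toFormalPeriod]))

/-- Under the kernel conjecture `P` is a domain (a subring of `ℝ`). [folklore] -/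
theorem isDomain_of_kernel (hK : KZKernelConjecture) : IsDomain FormalPeriodRing :=
  (kzKernelConjecture_iff_injective_evalP.mp hK).isDomain evalP

/-- `P` a domain ⇒ the crux. This is the honest logical position: the crux is the shadow
"no nilpotents" of "no zero-divisors", itself the shadow of injectivity of `evalP`. [folklore] -/
theorem reducedPeriodRing_of_isDomain (h : IsDomain FormalPeriodRing) : ReducedPeriodRing :=
  reducedPeriodRing_iff_isReduced.mpr inferInstance


/-! ## §2 Load-bearing analysis: the single hypothesis `c * c ∈ relations`

The crux has one hypothesis. Dropping it gives `relations = ⊤` (false: `[pt, 1]` evaluates to `1`);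
weakening it to its only known consequence `eval c = 0` (`eval_eq_zero_of_sq_mem_relations`) gives
the kernel conjecture, i.e. the summit itself. So the crux sits strictly between "trivial" and
"summit", and any proof must use the SQUARE, not merely its value. -/

/-- The crux with its hypothesis dropped. -/
def ReducedPeriodRingWithoutSq : Prop :=
  ∀ c : FormalRep, c ∈ relations

/-- **Any proof must use the hypothesis**: `[pt, 1] ∉ relations` (it evaluates to `1`). [folklore] -/
theorem reducedPeriodRing_false_without_sq : ¬ ReducedPeriodRingWithoutSq := by
  intro h
  have h0 : eval (of IntegralRep.unit) = 0 := relations_le_ker_eval_holds (h _)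
  rw [eval_of, IntegralRep.value_unit] at h0
  exact one_ne_zero h0

/-- The crux with its hypothesis weakened to `eval c = 0` (the only invariant of `c * c ∈ relations`
known in the tree). -/
def ReducedPeriodRingWithEvalHyp : Prop :=
  ∀ c : FormalRep, eval c = 0 → c ∈ relations

/-- **Weakening the hypothesis to its value gives back the summit** (verbatim the kernel
conjecture, `kzKernelConjecture_iff_isRational`). [folklore] -/
theorem reducedPeriodRingWithEvalHyp_iff_summit :
    ReducedPeriodRingWithEvalHyp ↔ KontsevichZagierPeriods :=
  (kzKernelConjecture_iff_isRational).trans KontsevichZagierPeriods_iff.symm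

/-- Between the two: the crux follows from the eval-form and implies nothing cheaper known. -/
theorem reducedPeriodRing_of_withEvalHyp (h : ReducedPeriodRingWithEvalHyp) : ReducedPeriodRing :=
  reducedPeriodRing_of_kernel h

/-! ## §3 Natural strengthenings

* `c * c ∈ relations → c = 0` (reducedness of `FormalRep` "on the nose") is FALSE: relations are
  not `⊥` (`not_reducedOnTheNose`).
* "no zero-divisors" (`P` a domain) and "`[π]` is regular" (`KZ.PiCancellation`) are the sibling
  shadows of injectivity; all follow from the kernel conjecture (`isDomain_of_kernel`), none is
  known, and §5 shows they are mutually independent over the abstract interface.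
* iterated squares: `c^(2^k) ∈ relations → c ∈ relations` is equivalent to the crux
  (`reducedPeriodRing_iff_sqIter`), and so is `x ^ n = 0 → x = 0` in `P` (`reducedPeriodRing_iff_pow`). -/

/-- **Refuted strengthening**: the on-the-nose version is false — `[∅] ≠ 0` in the free abelian
group but `[∅] ∈ relations` (hence `[∅]·[∅] ∈ relations`). [folklore] -/
theorem not_reducedOnTheNose : ¬ ∀ c : FormalRep, c * c ∈ relations → c = 0 := by
  intro h
  have hmem : of (IntegralRep.empty 0) ∈ relations := IntegralRep.of_empty_mem_relations
  have hsq : of (IntegralRep.empty 0) * of (IntegralRep.empty 0) ∈ relations :=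
    mul_mem_relations_right_holds _ _ hmem
  exact FreeAbelianGroup.of_ne_zero _ (h _ hsq)

/-- Iterated squares `c, c², c⁴, …` (left-nested powers are not needed: `P` is associative only
modulo relations, `KZ.mul_assoc_sub_mem_relations`). -/
def sqIter : ℕ → FormalRep → FormalRep
  | 0, c => c
  | k + 1, c => sqIter k c * sqIter k c

/-- The crux is equivalent to its iterated form `c^(2^k) ∈ relations → c ∈ relations`. [folklore] -/
theorem reducedPeriodRing_iff_sqIter :
    ReducedPeriodRing ↔ ∀ (k : ℕ) (c : FormalRep), sqIter k c ∈ relations → c ∈ relations := by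
  constructor
  · intro h k
    induction k with
    | zero => intro c hc; exact hc
    | succ k ih => intro c hc; exact ih c (h _ hc)
  · intro h c hc
    exact h 1 c hc

/-- Ring form of the same remark: the crux is `x ^ n = 0 → x = 0` in `P` for every `n`. [folklore] -/
theorem reducedPeriodRing_iff_pow :
    ReducedPeriodRing ↔ ∀ (x : FormalPeriodRing) (n : ℕ), x ^ n = 0 → x = 0 := by
  rw [reducedPeriodRing_iff_isReduced]
  exact ⟨fun h x n hx => h.eq_zero x ⟨n, hx⟩, fun h => ⟨fun x ⟨n, hx⟩ => h x n hx⟩⟩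

/-- What the route ACTUALLY consumes (Furusho's theorem over the residue fields of `P_ℚ` puts each
double-shuffle defect `d` in every prime, i.e. makes it nilpotent): nilpotent classes vanish. This is
literally `IsReduced P`, i.e. the crux — no weaker global statement does the job, but only the
defects `d` in the MZV subring are ever fed to it. -/
theorem route_usage (h : ReducedPeriodRing) {c : FormalRep} (hn : IsNilpotent (toFormalPeriod c)) :
    c ∈ relations :=
  toFormalPeriod_eq_zero_iff.mp ((reducedPeriodRing_iff_isReduced.mp h).eq_zero _ hn)

/-! ## §4 Where the crux HOLDS: sub-calculi free of nilpotents

Tools first (all `sorry`-free; the null-domain / zero-integrand / congruence lemmas are the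
tree's, `KZLogCalculusProofs.lean`): a.e.-zero integrands are relations; then the
**positive cone** `cone` (sums of representations with non-negative integrands) satisfies the kernel
conjecture outright (`mem_relations_of_mem_cone_of_eval_eq_zero`), hence carries no nilpotent
(`reducedPeriodRing_on_cone`): **a counterexample needs signed cancellation between at least two
representations.** -/

section Tools

open MeasureTheory Set
open Literature.ModelTheory.ExponentialFields (IsSemialgebraic tarski_seidenberg_real_holds
  isSemialgebraic_setOf_eval_eq_zero isSemialgebraic_setOf_eval_ne_zero)

variable {n : ℕ}

/-! Reused from the tree (`KZLogCalculusProofs.lean`): `KZ.of_mem_relations_of_volume_eq_zero`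
(null domain ⇒ relation), `KZ.of_mem_relations_of_eqOn_zero` (zero integrand ⇒ relation),
`KZ.exists_zeroRep`, `KZ.of_sub_of_mem_relations_of_eqOn` (same domain, integrands agree on it ⇒
equivalent), `KZ.of_add_of_mem_relations_of_eqOn_neg`. -/

/-- The zero locus `{x ∈ σ | f x = 0}` of the integrand is `ℚ`-semialgebraic (graph elimination,
Tarski–Seidenberg). [BCR 1998, Thm. 2.2.1] -/
theorem isSemialgebraic_sep_integrand_eq_zero (r : IntegralRep n) :
    IsSemialgebraic ℚ {x | x ∈ r.domain ∧ r.integrand x = 0} := by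
  have hT : IsSemialgebraic ℚ {z : Fin (n + 1) → ℝ | z (Fin.last n) = 0} := by
    simpa using isSemialgebraic_setOf_eval_eq_zero (k := ℚ) (R := ℝ)
      (MvPolynomial.X (Fin.last n) : MvPolynomial (Fin (n + 1)) ℚ)
  convert r.isSemialgebraicFunOn_integrand.isSemialgebraic_sep_snoc_mem
    tarski_seidenberg_real_holds hT using 1
  ext x
  simp

/-- The non-vanishing locus `{x ∈ σ | f x ≠ 0}` of the integrand is `ℚ`-semialgebraic. -/
theorem isSemialgebraic_sep_integrand_ne_zero (r : IntegralRep n) :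
    IsSemialgebraic ℚ {x | x ∈ r.domain ∧ r.integrand x ≠ 0} := by
  have hT : IsSemialgebraic ℚ {z : Fin (n + 1) → ℝ | z (Fin.last n) ≠ 0} := by
    simpa using isSemialgebraic_setOf_eval_ne_zero (k := ℚ) (R := ℝ)
      (MvPolynomial.X (Fin.last n) : MvPolynomial (Fin (n + 1)) ℚ)
  convert r.isSemialgebraicFunOn_integrand.isSemialgebraic_sep_snoc_mem
    tarski_seidenberg_real_holds hT using 1
  ext x
  simp

/-- **An a.e.-vanishing integrand gives a relation**: split `σ = {f = 0} ∪ {f ≠ 0}` (domain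
additivity); the first piece has zero integrand, the second is null.
[Kontsevich–Zagier 2001, §1.2 rule (1)] -/
theorem of_mem_relations_of_volume_ne_zero (r : IntegralRep n)
    (h : volume {x | x ∈ r.domain ∧ r.integrand x ≠ 0} = 0) : of r ∈ relations := by
  set Z : Set (Fin n → ℝ) := {x | x ∈ r.domain ∧ r.integrand x = 0} with hZ
  set N : Set (Fin n → ℝ) := {x | x ∈ r.domain ∧ r.integrand x ≠ 0} with hN
  have hZs : IsSemialgebraic ℚ Z := isSemialgebraic_sep_integrand_eq_zero r
  have hNs : IsSemialgebraic ℚ N := isSemialgebraic_sep_integrand_ne_zero r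
  set rZ : IntegralRep n := r.restrict Z hZs (fun x hx => hx.1) with hrZ
  set rN : IntegralRep n := r.restrict N hNs (fun x hx => hx.1) with hrN
  have hZN : Z ∩ N = ∅ := by
    rw [Set.eq_empty_iff_forall_notMem]
    rintro x ⟨hxZ, hxN⟩
    exact hxN.2 hxZ.2
  have hsplit : of r - of rZ - of rN ∈ domainAddRel := by
    refine ⟨n, r, rZ, rN, ?_, ?_, fun _ _ => rfl, fun _ _ => rfl, rfl⟩
    · ext x
      simp only [hrZ, hrN, IntegralRep.domain_restrict, mem_union, hZ, hN, mem_setOf_eq]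
      tauto
    · simp [hrZ, hrN, hZN]
  have h1 := domainAddRel_subset_relations hsplit
  have h2 : of rZ ∈ relations := of_mem_relations_of_eqOn_zero rZ (fun x hx => hx.2)
  have h3 : of rN ∈ relations := of_mem_relations_of_volume_eq_zero rN h
  have heq : of r = (of r - of rZ - of rN) + of rZ + of rN := by abel
  rw [heq]
  exact relations.add_mem (relations.add_mem h1 h2) h3

/-- A non-negative integrand with integral `0` vanishes a.e. on the domain
(`MeasureTheory.setIntegral_eq_zero_iff_of_nonneg_ae`). [folklore] -/
theorem volume_ne_zero_eq_zero_of_nonneg (r : IntegralRep n)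
    (h0 : ∀ x ∈ r.domain, 0 ≤ r.integrand x) (hv : r.value = 0) :
    volume {x | x ∈ r.domain ∧ r.integrand x ≠ 0} = 0 := by
  have hmeas : MeasurableSet r.domain := IntegralRep.measurableSet_domain_holds r
  have hae : 0 ≤ᵐ[volume.restrict r.domain] r.integrand := by
    rw [Filter.EventuallyLE, ae_restrict_iff' hmeas]
    exact Filter.Eventually.of_forall h0
  have h := (setIntegral_eq_zero_iff_of_nonneg_ae hae r.integrableOn).mp hv
  rw [Filter.EventuallyEq, ae_restrict_iff' hmeas, ae_iff] at h
  convert h using 2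
  ext x
  simp [Classical.not_imp]

/-- **A non-negative representation of value `0` is a relation.** [folklore] -/
theorem of_mem_relations_of_nonneg_of_value_eq_zero (r : IntegralRep n)
    (h0 : ∀ x ∈ r.domain, 0 ≤ r.integrand x) (hv : r.value = 0) : of r ∈ relations :=
  of_mem_relations_of_volume_ne_zero r (volume_ne_zero_eq_zero_of_nonneg r h0 hv)

end Tools

section Cone

open MeasureTheory Set

/-- The non-negative generators `⟨n, [σ, f]⟩`, `f ≥ 0` on `σ`. -/
def nonnegGens : Set (Σ n, IntegralRep n) := {x | ∀ y ∈ x.2.domain, 0 ≤ x.2.integrand y}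

/-- **The positive cone** `ℕ[non-negative representations] ⊆ FormalRep`. -/
def cone : AddSubmonoid FormalRep := AddSubmonoid.closure (FreeAbelianGroup.of '' nonnegGens)

/-- `[r] ∈ cone` for non-negative `r`. -/
theorem of_mem_cone {n : ℕ} (r : IntegralRep n) (hr : ∀ y ∈ r.domain, 0 ≤ r.integrand y) :
    of r ∈ cone :=
  AddSubmonoid.subset_closure ⟨⟨n, r⟩, hr, rfl⟩

/-- Elements of the cone evaluate non-negatively. -/
theorem eval_nonneg_of_mem_cone {c : FormalRep} (hc : c ∈ cone) : 0 ≤ eval c := by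
  induction hc using AddSubmonoid.closure_induction with
  | mem x hx =>
    obtain ⟨⟨n, r⟩, hr, rfl⟩ := hx
    change 0 ≤ eval (of r)
    rw [eval_of]
    exact setIntegral_nonneg (IntegralRep.measurableSet_domain_holds r) hr
  | zero => simp
  | add x y _ _ hx hy => rw [map_add]; exact add_nonneg hx hy

/-- **The kernel conjecture holds on the positive cone**: a sum of non-negative representations
of total value `0` is a relation (each summand has value `0`, hence an a.e.-zero integrand). -/
theorem mem_relations_of_mem_cone_of_eval_eq_zero {c : FormalRep} (hc : c ∈ cone)
    (h0 : eval c = 0) : c ∈ relations := by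
  induction hc using AddSubmonoid.closure_induction with
  | mem x hx =>
    obtain ⟨⟨n, r⟩, hr, rfl⟩ := hx
    change of r ∈ relations
    change eval (of r) = 0 at h0
    rw [eval_of] at h0
    exact of_mem_relations_of_nonneg_of_value_eq_zero r hr h0
  | zero => exact relations.zero_mem
  | add x y hx hy ihx ihy =>
    rw [map_add] at h0
    have hx0 := eval_nonneg_of_mem_cone hx
    have hy0 := eval_nonneg_of_mem_cone hy
    exact relations.add_mem (ihx (by linarith)) (ihy (by linarith))

/-- **The crux holds on the positive cone** (and, symmetrically, on `-cone`): a counterexample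
to `ReducedPeriodRing` is never a sum of non-negative representations — it needs signed
cancellation. -/
theorem reducedPeriodRing_on_cone {c : FormalRep} (hc : c ∈ cone) (h : c * c ∈ relations) :
    c ∈ relations :=
  mem_relations_of_mem_cone_of_eval_eq_zero hc (eval_eq_zero_of_sq_mem_relations h)

/-- The symmetric statement on `-cone`. -/
theorem reducedPeriodRing_on_neg_cone {c : FormalRep} (hc : -c ∈ cone) (h : c * c ∈ relations) :
    c ∈ relations := by
  have h' : (-c) * (-c) ∈ relations := by simpa using h
  simpa using relations.neg_mem (reducedPeriodRing_on_cone hc h')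

/-- **AM–GM form of the crux.** For `P, Q` in the cone, `(P − Q)² ∈ relations` reads
`P² + Q² ∼ PQ + QP`; the crux for `c = P − Q` says this forces `P ∼ Q`. Since every formal
combination is `P − Q` with `P, Q` sums of generators, and — after splitting each generator along
the sign of its integrand, §4b — with `P, Q ∈ cone`, the crux is EQUIVALENT to this sign-free
rigidity statement (the decomposition half is `exists_cone_sub_cone` below). [folklore] -/
theorem reducedPeriodRing_iff_amgm_all :
    ReducedPeriodRing ↔
      ∀ P Q : FormalRep, P * P + Q * Q - (P * Q + Q * P) ∈ relations → P - Q ∈ relations := by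
  have key : ∀ P Q : FormalRep, (P - Q) * (P - Q) = P * P + Q * Q - (P * Q + Q * P) := by
    intro P Q; simp only [sub_mul, mul_sub]; abel
  constructor
  · intro h P Q hPQ
    exact h _ (by rw [key]; exact hPQ)
  · intro h c hc
    have := h c 0 (by simpa using hc)
    simpa using this

end Cone

/-! ## §5 The abstract interface decides nothing (independence models)

Everything the tree knows about `(P, evalP)` abstractly: `P` is a non-trivial commutative ring,
`evalP : P →+* ℝ` a ring homomorphism onto the real periods, relations = `ker (FormalRep → P)`.
Over this interface reducedness is INDEPENDENT: `ℝ` itself is a reduced model, the dual numbers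
are a non-reduced one (`abstract_interface_admits_nilpotents`). Moreover the three shadows of
injectivity — reduced / `[π]`-regular (cancellation by elements of non-zero value) / torsion-free —
are pairwise independent (`sqrtGap_model`, `abstract_interface_admits_nilpotents`): in particular
the **square-root gaps** of route Neg (Das 2000: a Γ-monomial whose square, not itself, follows from
the distribution relations; generally any finite-index lattice phenomenon `L ⊊ Λ`) live in a group
algebra `ℚ[Λ/L]`, which is REDUCED (char 0, Maschke) — they yield zero-divisors and idempotents
`(1 ± g)/2`, never nilpotents. The smallest instance `ℚ[ℤ/2] ≅ ℚ × ℚ` is `sqrtGap_model`. -/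

section Models

/-- **Nilpotents are consistent with the abstract interface**: a commutative ring with a surjective
evaluation character in which every element of non-zero value is cancellable (so the analogue of
`PiCancellation` and of `IntegerDivision` hold) and which is nevertheless NOT reduced — the dual
numbers `ℚ[ε]`, `ev = ` standard part. Hence no argument using only "relations is an ideal, eval is
a ring hom, soundness" can prove the crux. [folklore] -/
theorem abstract_interface_admits_nilpotents :
    ∃ (R : Type) (_ : CommRing R) (ev : R →+* ℚ), Function.Surjective ev ∧
      (∀ x : R, ev x ≠ 0 → ∀ y : R, x * y = 0 → y = 0) ∧ ¬ IsReduced R := by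
  refine ⟨DualNumber ℚ, inferInstance, (TrivSqZeroExt.fstHom ℚ ℚ ℚ).toRingHom, ?_, ?_, ?_⟩
  · intro q
    exact ⟨TrivSqZeroExt.inl q, by simp⟩
  · intro x hx y hxy
    have hu : IsUnit x := by
      rw [TrivSqZeroExt.isUnit_iff_isUnit_fst, isUnit_iff_ne_zero]
      simpa using hx
    exact (hu.mul_right_eq_zero).mp hxy
  · intro hred
    have hnil : IsNilpotent (DualNumber.eps : DualNumber ℚ) :=
      ⟨2, by rw [pow_two]; exact DualNumber.eps_mul_eps⟩
    have h0 := hred.eq_zero _ hnil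
    have := congrArg TrivSqZeroExt.snd h0
    simp at this

/-- **Square-root gaps are not nilpotents**: a REDUCED commutative ring with an evaluation
character `ev` and two elements `x ≠ y` with `ev x = ev y` and `x² = y²` (so `(x − y)(x + y) = 0`
with `ev (x + y) ≠ 0`: cancellation fails, a zero-divisor and the idempotent `(1 + xy⁻¹)/2`
appear) — `ℚ × ℚ = ℚ[ℤ/2]`, `x = 1`, `y = g`. This is the exact algebraic shape of Neg's
`CancellationGap` / Das-type Γ-monomial witnesses; they cannot refute THIS crux. [folklore] -/
theorem sqrtGap_model :
    ∃ (R : Type) (_ : CommRing R) (ev : R →+* ℚ) (x y : R), IsReduced R ∧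
      ev x = ev y ∧ x ^ 2 = y ^ 2 ∧ x ≠ y ∧ (x - y) * (x + y) = 0 ∧ ev (x + y) ≠ 0 := by
  refine ⟨ℚ × ℚ, inferInstance, RingHom.fst ℚ ℚ, (1, 1), (1, -1), inferInstance, ?_, ?_, ?_, ?_, ?_⟩
  · simp
  · ext <;> simp
  · norm_num [Prod.ext_iff]
  · ext <;> simp
  · simp

/-- The reduced model `ℝ` (injective evaluation): the abstract interface does not REFUTE the crux
either. [folklore] -/
theorem abstract_interface_admits_reduced :
    ∃ (R : Type) (_ : CommRing R) (ev : R →+* ℝ), Function.Injective ev ∧ IsReduced R :=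
  ⟨ℝ, inferInstance, RingHom.id ℝ, fun _ _ h => h, inferInstance⟩

end Models


/-! ## §4b Sign decomposition: every formal combination is `P − Q` with `P, Q` in the cone

Together with `reducedPeriodRing_iff_amgm_all` this makes the crux EQUIVALENT to AM–GM rigidity
on the positive cone (`reducedPeriodRing_iff_amgm_cone`): the sign-free fragment of the
two-representation conjecture that a proof has to establish, and the shape any counterexample has
(two sums of NON-NEGATIVE representations `P ≁ Q` with `P² + Q² ∼ PQ + QP`). -/

section SignSplit

open MeasureTheory Set
open Literature.ModelTheory.ExponentialFields (IsSemialgebraic tarski_seidenberg_real_holds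
  isSemialgebraic_setOf_eval_nonneg isSemialgebraic_setOf_eval_pos)

variable {n : ℕ}

/-- `[σ, f] + [σ, −f] ∈ relations` (integrand additivity `0 = f + (−f)`;
`KZ.of_add_of_mem_relations_of_eqOn_neg`). [KZ 2001, §1.2 rule (1)] -/
theorem of_add_of_neg_mem_relations (r : IntegralRep n) : of r + of r.neg ∈ relations :=
  of_add_of_mem_relations_of_eqOn_neg (r := r) (r' := r.neg) rfl (fun _ _ => rfl)

/-- The non-negative locus `{x ∈ σ | 0 ≤ f x}` is `ℚ`-semialgebraic. [BCR 1998, Thm. 2.2.1] -/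
theorem isSemialgebraic_sep_integrand_nonneg (r : IntegralRep n) :
    IsSemialgebraic ℚ {x | x ∈ r.domain ∧ 0 ≤ r.integrand x} := by
  have hT : IsSemialgebraic ℚ {z : Fin (n + 1) → ℝ | 0 ≤ z (Fin.last n)} := by
    simpa using isSemialgebraic_setOf_eval_nonneg (k := ℚ) (R := ℝ)
      (MvPolynomial.X (Fin.last n) : MvPolynomial (Fin (n + 1)) ℚ)
  convert r.isSemialgebraicFunOn_integrand.isSemialgebraic_sep_snoc_mem
    tarski_seidenberg_real_holds hT using 1
  ext x
  simp

/-- The negative locus `{x ∈ σ | f x < 0}` is `ℚ`-semialgebraic. [BCR 1998, Thm. 2.2.1] -/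
theorem isSemialgebraic_sep_integrand_neg (r : IntegralRep n) :
    IsSemialgebraic ℚ {x | x ∈ r.domain ∧ r.integrand x < 0} := by
  have hT : IsSemialgebraic ℚ {z : Fin (n + 1) → ℝ | z (Fin.last n) < 0} := by
    have := isSemialgebraic_setOf_eval_pos (k := ℚ) (R := ℝ)
      (-(MvPolynomial.X (Fin.last n)) : MvPolynomial (Fin (n + 1)) ℚ)
    simpa using this
  convert r.isSemialgebraicFunOn_integrand.isSemialgebraic_sep_snoc_mem
    tarski_seidenberg_real_holds hT using 1
  ext x
  simp

/-- **Sign split of one representation**: `[σ, f] ∼ [σ₊, f] − [σ₋, −f]` with both pieces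
non-negative (`σ₊ = {f ≥ 0}`, `σ₋ = {f < 0}`; domain additivity + `of_add_of_neg_mem_relations`).
[Kontsevich–Zagier 2001, §1.2 rule (1)] -/
theorem exists_cone_sub_cone_of (r : IntegralRep n) :
    ∃ P Q : FormalRep, P ∈ cone ∧ Q ∈ cone ∧ of r - (P - Q) ∈ relations := by
  set Sp : Set (Fin n → ℝ) := {x | x ∈ r.domain ∧ 0 ≤ r.integrand x} with hSp
  set Sm : Set (Fin n → ℝ) := {x | x ∈ r.domain ∧ r.integrand x < 0} with hSm
  have hSps : IsSemialgebraic ℚ Sp := isSemialgebraic_sep_integrand_nonneg r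
  have hSms : IsSemialgebraic ℚ Sm := isSemialgebraic_sep_integrand_neg r
  set rp : IntegralRep n := r.restrict Sp hSps (fun x hx => hx.1) with hrp
  set rm : IntegralRep n := r.restrict Sm hSms (fun x hx => hx.1) with hrm
  have hdisj : Sp ∩ Sm = ∅ := by
    rw [Set.eq_empty_iff_forall_notMem]
    rintro x ⟨hxp, hxm⟩
    exact absurd hxm.2 (not_lt.mpr hxp.2)
  have hsplit : of r - of rp - of rm ∈ domainAddRel := by
    refine ⟨n, r, rp, rm, ?_, ?_, fun _ _ => rfl, fun _ _ => rfl, rfl⟩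
    · ext x
      simp only [hrp, hrm, IntegralRep.domain_restrict, mem_union, hSp, hSm, mem_setOf_eq]
      constructor
      · intro hx
        rcases le_or_gt 0 (r.integrand x) with h | h
        · exact Or.inl ⟨hx, h⟩
        · exact Or.inr ⟨hx, h⟩
      · rintro (⟨hx, -⟩ | ⟨hx, -⟩) <;> exact hx
    · simp [hrp, hrm, hdisj]
  refine ⟨of rp, of rm.neg, of_mem_cone rp (fun x hx => hx.2),
    of_mem_cone rm.neg (fun x hx => ?_), ?_⟩
  · have hx' : r.integrand x < 0 := hx.2
    simp only [IntegralRep.integrand_neg, Pi.neg_apply, hrm, IntegralRep.integrand_restrict]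
    linarith
  · have h1 := domainAddRel_subset_relations hsplit
    have h2 := of_add_of_neg_mem_relations rm
    have heq : of r - (of rp - of rm.neg) = (of r - of rp - of rm) + (of rm + of rm.neg) := by abel
    rw [heq]
    exact relations.add_mem h1 h2

/-- **Every formal combination is a difference of two cone elements modulo relations.** [folklore] -/
theorem exists_cone_sub_cone (c : FormalRep) :
    ∃ P Q : FormalRep, P ∈ cone ∧ Q ∈ cone ∧ c - (P - Q) ∈ relations := by
  induction c using FreeAbelianGroup.induction_on with
  | zero => exact ⟨0, 0, cone.zero_mem, cone.zero_mem, by simp [relations.zero_mem]⟩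
  | of x => obtain ⟨n, r⟩ := x; exact exists_cone_sub_cone_of r
  | neg x ih =>
    obtain ⟨P, Q, hP, hQ, h⟩ := ih
    refine ⟨Q, P, hQ, hP, ?_⟩
    have heq : -FreeAbelianGroup.of x - (Q - P) = -(FreeAbelianGroup.of x - (P - Q)) := by abel
    rw [heq]
    exact relations.neg_mem h
  | add x y hx hy =>
    obtain ⟨P, Q, hP, hQ, h⟩ := hx
    obtain ⟨P', Q', hP', hQ', h'⟩ := hy
    refine ⟨P + P', Q + Q', cone.add_mem hP hP', cone.add_mem hQ hQ', ?_⟩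
    have heq : x + y - (P + P' - (Q + Q')) = (x - (P - Q)) + (y - (P' - Q')) := by abel
    rw [heq]
    exact relations.add_mem h h'

/-- **The crux ⇔ AM–GM rigidity on the positive cone**: `ReducedPeriodRing` holds iff for all
sums `P, Q` of NON-NEGATIVE representations, a move chain `P² + Q² ∼ PQ + QP` forces `P ∼ Q`.
(Values: `p² + q² = 2pq` forces `p = q` in `ℝ` because squares of non-zero reals are POSITIVE; the
calculus knows positivity only after integration — `mem_relations_of_mem_cone_of_eval_eq_zero` —
while `(P − Q)²` is not a cone element at the level of integrands: `(f−g)⊗(f−g)` changes sign.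
That gap is the whole difficulty.) [folklore] -/
theorem reducedPeriodRing_iff_amgm_cone :
    ReducedPeriodRing ↔
      ∀ P Q : FormalRep, P ∈ cone → Q ∈ cone →
        P * P + Q * Q - (P * Q + Q * P) ∈ relations → P - Q ∈ relations := by
  constructor
  · intro h P Q _ _ hPQ
    exact (reducedPeriodRing_iff_amgm_all.mp h) P Q hPQ
  · intro h c hc
    obtain ⟨P, Q, hP, hQ, hd⟩ := exists_cone_sub_cone c
    have key : (P - Q) * (P - Q) = P * P + Q * Q - (P * Q + Q * P) := by
      simp only [sub_mul, mul_sub]; abel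
    -- `(P - Q)² ∼ c²` since `P - Q ∼ c` (two-sided ideal)
    have hd' : (P - Q) - c ∈ relations := by
      have := relations.neg_mem hd
      simpa using this
    have hsq : (P - Q) * (P - Q) - c * c ∈ relations := mul_sub_mul_mem_relations hd' hd'
    have hPQ : P * P + Q * Q - (P * Q + Q * P) ∈ relations := by
      rw [← key]
      have := relations.add_mem hsq hc
      simpa using this
    have h1 : P - Q ∈ relations := h P Q hP hQ hPQ
    have := relations.add_mem hd h1
    simpa using this

end SignSplit

/-! ## §6 Divisibility of `P` and the shape of a certificate

A refutation is an additive map `φ : FormalRep →+ A` killing the four move families with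
`φ c ≠ 0` for some `c` with `c * c ∈ relations` (`not_reducedPeriodRing_iff_certificate`; the
universal one is `toFormalPeriod`). What `φ` can NOT be:
* anything factoring through `eval` (`certificate_comp_eval_vanishes`);
* multiplicative with values in a REDUCED ring — `eval`, `evalP`, every "realisation" `χ` of the
  rules as in `PentagonInKZ`, every character of `P` (`multiplicative_certificate_vanishes`);
* valued in a group of bounded exponent, e.g. finite or `𝔽ₚ`-linear invariants (parity of a
  cell count, …): `P` is DIVISIBLE (`exists_sub_nsmul_mem_relations`: `[σ, f] ∼ N • [σ, f/N]`, via the tree's `constMul`), so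
  such `φ` vanish identically (`bounded_exponent_certificate_vanishes`).
So a certificate is `ℚ`-linear in effect, non-multiplicative (or nilpotent-valued), and does not
factor through the value: a genuinely new additive invariant of semialgebraic integrals. -/

section Certificates

open MeasureTheory Set MvPolynomial

variable {n : ℕ}

/-- **Certificate shape.** [folklore] -/
theorem not_reducedPeriodRing_iff_certificate :
    ¬ ReducedPeriodRing ↔
      ∃ (A : Type) (_ : AddCommGroup A) (φ : FormalRep →+ A),
        (∀ c ∈ relations, φ c = 0) ∧ ∃ c : FormalRep, c * c ∈ relations ∧ φ c ≠ 0 := by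
  constructor
  · intro h
    obtain ⟨c, hc⟩ := not_forall.mp h
    obtain ⟨hcc, hcn⟩ := Classical.not_imp.mp hc
    refine ⟨FormalPeriodRing, inferInstance, (toFormalPeriod : FormalRep →ₙ+* FormalPeriodRing),
      fun d hd => toFormalPeriod_eq_zero_of_mem hd, c, hcc, ?_⟩
    change toFormalPeriod c ≠ 0
    rwa [Ne, toFormalPeriod_eq_zero_iff]
  · rintro ⟨A, _, φ, hφ, c, hc, hne⟩ h
    exact hne (hφ c (h c hc))

/-- Certificates factoring through the value vanish on every candidate. [folklore] -/
theorem certificate_comp_eval_vanishes {A : Type*} [AddCommGroup A] (g : ℝ →+ A) {c : FormalRep}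
    (hc : c * c ∈ relations) : g.comp eval c = 0 := by
  rw [AddMonoidHom.comp_apply, eval_eq_zero_of_sq_mem_relations hc, map_zero]

/-- **Multiplicative certificates into reduced rings vanish on every candidate**: if
`φ : FormalRep →ₙ+* R` kills the relations and `R` is reduced then `φ c = 0` whenever
`c * c ∈ relations` (`φ c` is nilpotent). Covers `eval`, `evalP`, and every realisation character
`χ` of the rules with reduced target. [folklore] -/
theorem multiplicative_certificate_vanishes {R : Type*} [CommRing R] [IsReduced R]
    (φ : FormalRep →ₙ+* R) (hφ : ∀ c ∈ relations, φ c = 0) {c : FormalRep}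
    (hc : c * c ∈ relations) : φ c = 0 := by
  have hsq : φ c * φ c = 0 := by rw [← map_mul]; exact hφ _ hc
  exact IsReduced.eq_zero _ ⟨2, by rw [pow_two]; exact hsq⟩

/-! Scaling is the tree's `KZ.IntegralRep.constMul` (`KZRelationsLE.lean`), and
`[σ, k f] ∼ k • [σ, f]` for `k : ℕ` is `KZ.IntegralRep.of_constMul_nat_sub_nsmul_mem_relations`
(`KZSubcalculusInvariants.lean`, iterated integrand additivity). -/

/-- `[σ, f] ∼ N • [σ, f/N]` for `N ≥ 1`. [KZ 2001, §1.2 rule (1)] -/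
theorem of_sub_nsmul_of_constMul_inv_mem_relations (r : IntegralRep n) {N : ℕ} (hN : 0 < N) :
    of r - N • of (r.constMul ((N : ℝ)⁻¹) (isAlgebraic_nat N).inv) ∈ relations := by
  have hN' : (N : ℝ) ≠ 0 := by exact_mod_cast hN.ne'
  have h1 : of r - of ((r.constMul ((N : ℝ)⁻¹) (isAlgebraic_nat N).inv).constMul (N : ℝ)
      (isAlgebraic_nat N)) ∈ relations :=
    of_sub_of_mem_relations_of_eqOn rfl (fun x _ => by simp [hN'])
  have h2 := (r.constMul ((N : ℝ)⁻¹) (isAlgebraic_nat N).inv).of_constMul_nat_sub_nsmul_mem_relations N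
  have := relations.add_mem h1 h2
  simpa using this

/-- **`P = FormalRep ⧸ relations` is a divisible group**: every formal combination is `N` times
another one modulo relations, for every `N ≥ 1`. [folklore] -/
theorem exists_sub_nsmul_mem_relations (c : FormalRep) {N : ℕ} (hN : 0 < N) :
    ∃ c' : FormalRep, c - N • c' ∈ relations := by
  induction c using FreeAbelianGroup.induction_on with
  | zero => exact ⟨0, by simp [relations.zero_mem]⟩
  | of x =>
    obtain ⟨n, r⟩ := x
    exact ⟨of (r.constMul ((N : ℝ)⁻¹) (isAlgebraic_nat N).inv),
      of_sub_nsmul_of_constMul_inv_mem_relations r hN⟩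
  | neg x ih =>
    obtain ⟨c', h⟩ := ih
    refine ⟨-c', ?_⟩
    have heq : -FreeAbelianGroup.of x - N • (-c') = -(FreeAbelianGroup.of x - N • c') := by
      rw [smul_neg]; abel
    rw [heq]
    exact relations.neg_mem h
  | add x y hx hy =>
    obtain ⟨c₁, h₁⟩ := hx
    obtain ⟨c₂, h₂⟩ := hy
    refine ⟨c₁ + c₂, ?_⟩
    have heq : x + y - N • (c₁ + c₂) = (x - N • c₁) + (y - N • c₂) := by
      rw [smul_add]; abel
    rw [heq]
    exact relations.add_mem h₁ h₂

/-- Divisibility of the formal period ring. [folklore] -/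
theorem formalPeriodRing_divisible (x : FormalPeriodRing) {N : ℕ} (hN : 0 < N) :
    ∃ y : FormalPeriodRing, x = N • y := by
  obtain ⟨c, rfl⟩ := toFormalPeriod_surjective x
  obtain ⟨c', h⟩ := exists_sub_nsmul_mem_relations c hN
  refine ⟨toFormalPeriod c', ?_⟩
  rw [← map_nsmul, toFormalPeriod_eq_iff]
  exact h

/-- **Bounded-exponent certificates vanish identically** (finite groups, `𝔽ₚ`-vector spaces, any
`A` with `N • A = 0`): the image of the divisible group `P` is divisible. In particular no parity /
counting invariant of the (domain, integrand) data can refute the crux. [folklore] -/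
theorem bounded_exponent_certificate_vanishes {A : Type*} [AddCommGroup A] (φ : FormalRep →+ A)
    (hφ : ∀ c ∈ relations, φ c = 0) {N : ℕ} (hN : 0 < N) (hA : ∀ a : A, N • a = 0)
    (c : FormalRep) : φ c = 0 := by
  obtain ⟨c', h⟩ := exists_sub_nsmul_mem_relations c hN
  have h0 : φ (c - N • c') = 0 := hφ _ h
  rw [map_sub, map_nsmul, hA, sub_zero] at h0
  exact h0

/-- With `IntegerDivision` (torsion-freeness, item 3934) divisibility makes `P` uniquely divisible,
i.e. a `ℚ`-vector space: the crux is then literally reducedness of a commutative `ℚ`-algebra, the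
setting of Furusho's theorem. Recorded as: multiplication by `N ≥ 1` is a bijection of `P`. -/
theorem nsmul_bijective_of_integerDivision (hI : IntegerDivision) {N : ℕ} (hN : 0 < N) :
    Function.Bijective fun x : FormalPeriodRing => N • x := by
  constructor
  · intro x y hxy
    obtain ⟨c, rfl⟩ := toFormalPeriod_surjective x
    obtain ⟨d, rfl⟩ := toFormalPeriod_surjective y
    have h : N • (c - d) ∈ relations := by
      rw [← toFormalPeriod_eq_zero_iff, map_nsmul, map_sub, smul_sub, sub_eq_zero]
      exact hxy
    exact toFormalPeriod_eq_iff.mpr (hI _ N hN h)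
  · intro x
    obtain ⟨y, hy⟩ := formalPeriodRing_divisible x hN
    exact ⟨y, hy.symm⟩

end Certificates


/-! ## §7 The smallest sub-calculus: dimension `0` (the constants) carries no nilpotent

The subgroup `dimZero` generated by the 0-dimensional representations `[τ, a]` (`τ ∈ {∅, pt}`,
`a` real algebraic) satisfies the kernel conjecture (`dimZero_kernel`): modulo relations every
element is ONE constant `[pt, a]` with `a = eval c`, and `[pt, 0] ∈ relations`. So the base of the
calculus is nilpotent-free (`reducedPeriodRing_dimZero`); e.g. `[pt, √2]² = [pt, 2]` behaves. -/

section DimZero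

open MeasureTheory Set
open Literature.ModelTheory.ExponentialFields (IsSemialgebraic isSemialgebraic_univ)

/-- The constants of the calculus: the subgroup generated by 0-dimensional representations. -/
def dimZero : AddSubgroup FormalRep := AddSubgroup.closure (Set.range fun r : IntegralRep 0 => of r)

/-- In dimension `0` the value is the value of the integrand at the point. [KZ 2001, §1.1] -/
theorem value_eq_integrand_default (r : IntegralRep 0) (h : r.domain = univ) :
    r.value = r.integrand default := by
  have hconst : r.integrand = fun _ => r.integrand default :=
    funext fun x => congrArg r.integrand (Subsingleton.elim x default)
  rw [IntegralRep.value, h, hconst, setIntegral_const]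
  simp [measureReal_def, volume_univ_fin_zero]

/-- Sum of two 0-dimensional representations with full domain. -/
def addRepZero (R₁ R₂ : IntegralRep 0) (h₁ : R₁.domain = univ) (h₂ : R₂.domain = univ) :
    IntegralRep 0 where
  domain := univ
  integrand := R₁.integrand + R₂.integrand
  isSemialgebraic_domain := isSemialgebraic_univ
  isSemialgebraicFunOn_integrand :=
    IsSemialgebraicFunOn.add_holds (h₁ ▸ R₁.isSemialgebraicFunOn_integrand)
      (h₂ ▸ R₂.isSemialgebraicFunOn_integrand)
  integrableOn := (h₁ ▸ R₁.integrableOn).add (h₂ ▸ R₂.integrableOn)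

/-- Every constant combination is ONE constant modulo relations. [folklore] -/
theorem exists_of_sub_mem_relations_of_mem_dimZero {c : FormalRep} (hc : c ∈ dimZero) :
    ∃ R : IntegralRep 0, R.domain = univ ∧ c - of R ∈ relations := by
  induction hc using AddSubgroup.closure_induction with
  | mem x hx =>
    obtain ⟨r, rfl⟩ := hx
    rcases Set.eq_empty_or_nonempty r.domain with h | h
    · obtain ⟨z, hzd, hzi⟩ := exists_zeroRep (n := 0) (isSemialgebraic_univ (k := ℚ))
      refine ⟨z, hzd, ?_⟩
      have h1 : of r ∈ relations := of_mem_relations_of_volume_eq_zero r (by rw [h]; simp)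
      exact relations.sub_mem h1 (of_mem_relations_of_eqOn_zero z (by simp [hzi, EqOn]))
    · exact ⟨r, Subsingleton.eq_univ_of_nonempty h, by simp [relations.zero_mem]⟩
  | zero =>
    obtain ⟨z, hzd, hzi⟩ := exists_zeroRep (n := 0) (isSemialgebraic_univ (k := ℚ))
    refine ⟨z, hzd, ?_⟩
    simpa using relations.neg_mem (of_mem_relations_of_eqOn_zero z (by simp [hzi, EqOn]))
  | add x y hx hy ihx ihy =>
    obtain ⟨R₁, h₁, hx₁⟩ := ihx
    obtain ⟨R₂, h₂, hy₂⟩ := ihy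
    refine ⟨addRepZero R₁ R₂ h₁ h₂, rfl, ?_⟩
    have hmem : of (addRepZero R₁ R₂ h₁ h₂) - of R₁ - of R₂ ∈ integrandAddRel :=
      ⟨0, addRepZero R₁ R₂ h₁ h₂, R₁, R₂, h₁, h₂, fun _ _ => rfl, rfl⟩
    have h3 := integrandAddRel_subset_relations hmem
    have heq : x + y - of (addRepZero R₁ R₂ h₁ h₂) =
        (x - of R₁) + (y - of R₂) - (of (addRepZero R₁ R₂ h₁ h₂) - of R₁ - of R₂) := by abel
    rw [heq]
    exact relations.sub_mem (relations.add_mem hx₁ hy₂) h3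
  | neg x hx ih =>
    obtain ⟨R, hR, hxR⟩ := ih
    refine ⟨R.neg, hR, ?_⟩
    have heq : -x - of R.neg = -(x - of R) - (of R + of R.neg) := by abel
    rw [heq]
    exact relations.sub_mem (relations.neg_mem hxR) (of_add_of_neg_mem_relations R)

/-- **The kernel conjecture holds on the constants.** [folklore] -/
theorem dimZero_kernel {c : FormalRep} (hc : c ∈ dimZero) (h0 : eval c = 0) : c ∈ relations := by
  obtain ⟨R, hR, hcR⟩ := exists_of_sub_mem_relations_of_mem_dimZero hc
  have hv : R.value = 0 := by
    have h1 : eval (c - of R) = 0 := relations_le_ker_eval_holds hcR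
    rw [map_sub, h0, eval_of, zero_sub, neg_eq_zero] at h1
    exact h1
  have hint : R.integrand default = 0 := by rwa [value_eq_integrand_default R hR] at hv
  have hRrel : of R ∈ relations :=
    of_mem_relations_of_eqOn_zero R (fun x _ => by
      rw [Subsingleton.elim x default, hint]; rfl)
  have := relations.add_mem hcR hRrel
  simpa using this

/-- **No nilpotent among the constants.** [folklore] -/
theorem reducedPeriodRing_dimZero {c : FormalRep} (hc : c ∈ dimZero) (h : c * c ∈ relations) :
    c ∈ relations :=
  dimZero_kernel hc (eval_eq_zero_of_sq_mem_relations h)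

end DimZero

/-! ## §8 Anatomy of a would-be witness (near-misses; nothing here is a kill)

**The only door is a common square.** `sq_sub_mem_relations_of_common_square`: if `a·a ∼ s`,
`b·b ∼ s` and `a·b ∼ s` by moves, then `c = a − b` has `c·c ∈ relations`; a nilpotent is such a
triple WITHOUT a chain `a ∼ b`. All three chains live one Fubini level up (products of domains),
where the calculus has strictly more moves available than on the factors: coordinate-MIXING
changes of variables (polar / Beukers–Calabi–Kolk type). Worked example (paper, not Lean): with
`r = [(0,∞), 1/(1+a²)]` (value π/2) and `s = [(0,1)², 1/(1−x²y²)]` (value π²/8) the calculus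
proves `[r]·[r] ∼ 2[s]`: the algebraic form of the BCK substitution
`x = a√((1+b²)/(1+a²)), y = b√((1+a²)/(1+b²))` maps `{a,b>0, ab<1}` onto `(0,1)²` with
`dx dy/(1−x²y²) = da db/((1+a²)(1+b²))` (one move (2)), `{ab<1} ∼ {ab>1}` by `(a,b) ↦ (1/a,1/b)`
(move (2)) and `{a,b>0} = {ab<1} ∪ {ab=1} ∪ {ab>1}` (move (1a), null wall). A nilpotent would be a
SECOND representation `r'` of π/2 with `[r']·[r'] ∼ 2[s]` and `[r]·[r'] ∼ 2[s]` provable while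
`r ∼ r'` is not; every candidate `r'` tried (half-disc area, `∫₀¹ dx/√(1−x²)` via the Weierstrass
substitution `x = 2a/(1+a²)`, `2∫₀¹ da/(1+a²)` via `a ↦ 1/a`) is move-equivalent to `r` in ≤ 3
moves. Why this resists in general: a product-level chain can be SLICED along a generic algebraic
fibre `{y = y₀}` move by move — additivity and Newton–Leibniz in an `x`-coordinate slice
trivially — EXCEPT at coordinate-mixing changes of variables; so a nilpotent witness must route
all three chains through mixing substitutions that have no fibrewise shadow, and no such
configuration with algebraic data is known (the Gaussian `∫e^{−x²}`, whose square IS easier than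
itself, is not algebraic; for algebraic `f`, separability of `f(x)f(y)` in polar or hyperbolic
coordinates forces `f` homogeneous, `f = |x|^β`, never integrable on a cone-invariant domain).

**Non-candidates** (recorded so nobody re-walks them):
* Γ-monomial square-root gaps (Das 2000; Deligne–Koblitz–Ogus lattice of index 2): give
  `x² ∼ y²`, i.e. the zero-divisor `(x−y)(x+y)` and the idempotent `(1 + x/y)/2`, never `(x−y)² ∼ 0`
  (`sqrtGap_model`; group algebras `ℚ[Λ/L]` are reduced).
* `[π]`-cancellation failures (route AyoubSpecialisation, `KZ.PiCancellation`): zero-divisors again.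
* MZV double-shuffle defects `d` (this route): Furusho over `P_ℚ/nil` makes them NILPOTENT
  unconditionally (given PentagonInKZ ∧ ShuffleIsDissection), so they are the natural test family —
  but each `d = P − Q` is a difference of two cone elements of equal value whose direct
  equivalence (StuffleInKZ, HoffmanRelationInKZ) is exactly what the other cruxes must prove; a
  proof of `d^N ∈ relations` that does not pass through `d ∈ relations` is not in sight either.
* dimension 0, the positive cone, null / a.e.-zero data: nilpotent-free (§4, §7).
* (cycle 2) one-dimensional GROUP-LAW sectors with `ℤ`-coefficients — the log sector
  `Σ nⱼ [(1, αⱼ), 1/x]` (`αⱼ` real algebraic `> 1`) and the Machin/arctan sector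
  `Σ nⱼ [(aⱼ, bⱼ), 1/(1+x²)]` (algebraic endpoints, RATIONAL numerators): their kernel conjecture is
  transcendence-FREE on paper (a `ℤ`-relation among real logs is a multiplicative relation in
  `(ℚ̄ ∩ ℝ)^×`, realised by the scalings `x ↦ αx` + interval additivity; a `ℤ`-relation among
  arctangents is a multiplicative relation among `(1 + iα)/|1 + iα|`, realised by the Möbius
  rotations `x ↦ (x + u)/(1 − ux)` — the addition law — plus splitting at the pole; independence of
  a multiplicative basis and `π ≠ 0` finish; for the Machin case cf. J. Calcut, Amer. Math. Monthly
  116 (2009) 515–530, Gaussian-integer factorisation), so `eval` is injective there and no witness is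
  supported in them. With ALGEBRAIC irrational numerators the same sectors need Baker (as the tree's
  `CurvePeriodsBakerProofs`). Not formalised (each addition-law step is a bespoke
  `changeOfVariablesRel` instance); recorded to stop re-walking.

**Literature** (pages read 2026-08-15; `lit search` itself was unavailable this session, rc 75):
* Reducedness / integrality of the KZ rules algebra is not in print either way. The nearest printed
  question is Cresson–Viu-Sos, *On the equality of periods of Kontsevich–Zagier* (JTNB 2022 =
  arXiv:1912.01751), Rem. 2.3 (p. 5 of the arXiv text): "it is natural to ask if `K₀(𝒞_saq)` is a
  domain, i.e. if it contains zero divisors as `K₀(Var_ℂ)`, even if intuitively this should not be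
  the case" — asked for ZERO-DIVISORS of the semialgebraic cut-and-paste ring, not for nilpotents;
  same page: a point class would be a zero-divisor there (in this calculus points of `ℝⁿ⁺¹` are null,
  hence relations, and `ℝ⁰` is the unit — `dimZero_kernel`), and Borisov 2018: `[𝔸¹]` is a
  zero-divisor in `K₀(Var_ℂ)`.
* The printed zero-divisors of cut-and-paste rings have EXACTLY the square-root-gap shape of
  `sqrtGap_model`: Poonen, *The Grothendieck ring of varieties is not a domain* (MRL 2002 =
  arXiv:math/0204306), §5 (p. 6): abelian varieties `A ≇ B` with `A × A ≅ B × B`, whence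
  `([A]+[B])([A]−[B]) = 0` with both factors non-zero — `x² = y²`, `x ≠ y`: a zero-divisor, not a
  nilpotent. No printed nilpotent in any such ring is known to this file.
* For Nori motives the full formal period algebra `P̃(MM_Nori) = O(torsor)` is reduced (smooth
  torsor under a pro-algebraic group in characteristic 0, Huber–Müller-Stach 2017 §13.2), and
  `P̃(MM_Nori) = P̃^eff[1/2πi]`; but "it is also an open question whether
  `P̃(MM^eff_Nori(ℚ̄,ℚ)) → P̃(MM_Nori(ℚ̄,ℚ))` is injective. By Proposition 7.17, this injectivity is a
  consequence of the Period Conjecture" (Huber–Wüstholz 2022, App. A.4, p. 200, read). So even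
  motivically, reducedness of the EFFECTIVE algebra is only known via the conjecture; transferring
  anything to the rules presentation needs in addition "rules ≡ motives" (open; HMS 2017 Rem. 13.1.8). -/

section Anatomy

/-- **The only door: a common square.** [folklore] -/
theorem sq_sub_mem_relations_of_common_square {a b s : FormalRep} (haa : a * a - s ∈ relations)
    (hbb : b * b - s ∈ relations) (hab : a * b - s ∈ relations) :
    (a - b) * (a - b) ∈ relations := by
  have hba : b * a - s ∈ relations := by
    have := relations.add_mem (mul_sub_mul_comm_mem_relations b a) hab
    simpa using this
  have heq : (a - b) * (a - b) = (a * a - s) + (b * b - s) - (a * b - s) - (b * a - s) := by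
    simp only [sub_mul, mul_sub]; abel
  rw [heq]
  exact relations.sub_mem (relations.sub_mem (relations.add_mem haa hbb) hab) hba

/-- Conversely the crux turns every common-square triple into an equivalence `a ∼ b`: this is the
"formal square-root extraction" the crux buys (and all it buys). [folklore] -/
theorem sub_mem_relations_of_common_square (h : ReducedPeriodRing) {a b s : FormalRep}
    (haa : a * a - s ∈ relations) (hbb : b * b - s ∈ relations) (hab : a * b - s ∈ relations) :
    a - b ∈ relations :=
  h _ (sq_sub_mem_relations_of_common_square haa hbb hab)

/-- The two-representation form of a witness: `¬ crux` iff some pair of single representations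
`r ≁ r'` (of possibly different dimensions) has `([r] − [r'])² ∈ relations` — by
`KZ.exists_integralRep_sub` every formal combination is `[r] − [r']` modulo relations. [folklore] -/
theorem not_reducedPeriodRing_iff_pair :
    ¬ ReducedPeriodRing ↔ ∃ (n m : ℕ) (r : IntegralRep n) (r' : IntegralRep m),
      (of r - of r') * (of r - of r') ∈ relations ∧ ¬ Equivalent r r' := by
  constructor
  · intro h
    obtain ⟨c, hc⟩ := not_forall.mp h
    obtain ⟨hcc, hcn⟩ := Classical.not_imp.mp hc
    obtain ⟨n, m, r, r', hd⟩ := exists_integralRep_sub_holds c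
    refine ⟨n, m, r, r', ?_, fun he => hcn ?_⟩
    · have hd' : (of r - of r') - c ∈ relations := by
        simpa using relations.neg_mem hd
      have h1 := mul_sub_mul_mem_relations hd' hd'
      have := relations.add_mem h1 hcc
      simpa using this
    · have := relations.add_mem hd he
      simpa using this
  · rintro ⟨n, m, r, r', hsq, hne⟩ h
    exact hne (h _ hsq)

/-- **Every formal period is the class of ONE (signed) representation**: `c ∼ [r] − [r']`
(`KZ.exists_integralRep_sub`) and `[r] + [r'.neg]` merge into one representation
(`KZ.IntegralRep.exists_of_add_of_sub_of_mem_relations`). [Kontsevich–Zagier 2001, §1.2] -/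
theorem exists_sub_of_mem_relations (c : FormalRep) :
    ∃ (N : ℕ) (R : IntegralRep N), c - of R ∈ relations := by
  obtain ⟨n, m, r, r', hd⟩ := exists_integralRep_sub_holds c
  obtain ⟨N, R, hR⟩ := IntegralRep.exists_of_add_of_sub_of_mem_relations r r'.neg
  refine ⟨N, R, ?_⟩
  have hneg : of r' + of r'.neg ∈ relations :=
    of_add_of_mem_relations_of_eqOn_neg (r := r') (r' := r'.neg) rfl (fun _ _ => rfl)
  have heq : c - of R = (c - (of r - of r')) + (of r + of r'.neg - of R) - (of r' + of r'.neg) := by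
    abel
  rw [heq]
  exact relations.sub_mem (relations.add_mem hd hR) hneg

/-- **Single-representation form of a witness** (the form ideator 3's card uses): `¬ crux` iff ONE
representation `u = [σ, f]` has `[σ × σ, f ⊗ f] ∈ relations` but `[σ, f] ∉ relations`. [folklore] -/
theorem not_reducedPeriodRing_iff_single :
    ¬ ReducedPeriodRing ↔
      ∃ (N : ℕ) (u : IntegralRep N), of (u.prod u) ∈ relations ∧ of u ∉ relations := by
  constructor
  · intro h
    obtain ⟨c, hc⟩ := not_forall.mp h
    obtain ⟨hcc, hcn⟩ := Classical.not_imp.mp hc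
    obtain ⟨N, u, hu⟩ := exists_sub_of_mem_relations c
    refine ⟨N, u, ?_, fun hu0 => hcn ?_⟩
    · have hd' : of u - c ∈ relations := by simpa using relations.neg_mem hu
      have h1 := mul_sub_mul_mem_relations hd' hd'
      rw [of_mul_of] at h1
      have := relations.add_mem h1 hcc
      simpa using this
    · have := relations.add_mem hu hu0
      simpa using this
  · rintro ⟨N, u, hsq, hne⟩ h
    exact hne (h _ (by rw [of_mul_of]; exact hsq))

/-- **A single-representation witness changes sign**: if `[u ⊠ u] ∈ relations` but
`[u] ∉ relations` then the integrand of `u` takes both a positive and a negative value on the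
domain (otherwise `±[u]` lies in the positive cone, where the crux is proved). [folklore] -/
theorem witness_changes_sign {N : ℕ} {u : IntegralRep N} (hsq : of (u.prod u) ∈ relations)
    (hne : of u ∉ relations) :
    (∃ x ∈ u.domain, 0 < u.integrand x) ∧ (∃ y ∈ u.domain, u.integrand y < 0) := by
  have hsq' : of u * of u ∈ relations := by rw [of_mul_of]; exact hsq
  by_contra hcon
  rw [not_and_or] at hcon
  rcases hcon with hpos | hneg
  · -- no positive value: `u ≤ 0`, so `u.neg` is in the cone
    push Not at hpos
    have hcone := of_mem_cone u.neg (fun y hy => by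
      have := hpos y hy
      simp only [IntegralRep.integrand_neg, Pi.neg_apply]
      linarith)
    have hun : of u.neg - (-of u) ∈ relations := by
      have h0 := of_add_of_mem_relations_of_eqOn_neg (r := u) (r' := u.neg) rfl (fun _ _ => rfl)
      have heq : of u.neg - (-of u) = of u + of u.neg := by abel
      rw [heq]
      exact h0
    have hsqn : of u.neg * of u.neg ∈ relations := by
      have h1 := mul_sub_mul_mem_relations hun hun
      have h2 : (-of u) * (-of u) ∈ relations := by simpa using hsq'
      have := relations.add_mem h1 h2
      simpa using this
    have h3 := reducedPeriodRing_on_cone hcone hsqn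
    have : of u ∈ relations := by
      have := relations.sub_mem h3 hun
      simpa using this
    exact hne this
  · -- no negative value: `u ≥ 0` is in the cone
    push Not at hneg
    exact hne (reducedPeriodRing_on_cone (of_mem_cone u hneg) hsq')

end Anatomy


/-! ## §6b By-product: every non-zero integer is a UNIT of `P`; `IntegerDivision` (item 3934) holds

Divisibility applied to `1 = ⟦[pt, 1]⟧` gives `1 = N • y = N · y`, so `N` is invertible in `P`
(`isUnit_natCast_formalPeriodRing`). Hence `P` is torsion-free — the route's support item
`IntegerDivision` (stmt-KontsevichZagierPeriods-3934) is a THEOREM (`integerDivision_holds`, ten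
lines; the planner's sketch via scaling maps on all four move families is not needed) — and `P` is
uniquely divisible, i.e. a `ℚ`-algebra in all but name: the localisation `P → P_ℚ = ℚ ⊗ P` inverts
only units. For THIS crux: reducedness of `P` and of `P_ℚ` are the same question, and Furusho's
theorem can be run over `P` directly. -/

section Units

/-- **Every positive integer is a unit of the formal period ring** (`1 ∼ N • [pt, 1/N]`). [folklore] -/
theorem isUnit_natCast_formalPeriodRing {N : ℕ} (hN : 0 < N) :
    IsUnit ((N : ℕ) : FormalPeriodRing) := by
  obtain ⟨y, hy⟩ := formalPeriodRing_divisible (1 : FormalPeriodRing) hN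
  rw [nsmul_eq_mul] at hy
  exact IsUnit.of_mul_eq_one y hy.symm

/-- **`IntegerDivision` holds**: `N • c ∈ relations → c ∈ relations` for `N ≥ 1` — settles the
route's support item stmt-KontsevichZagierPeriods-3934 (candidate proof; a prover lands it).
[Kontsevich–Zagier 2001, §1.2] -/
theorem integerDivision_holds : IntegerDivision := by
  intro c N hN h
  rw [← toFormalPeriod_eq_zero_iff] at h ⊢
  rw [map_nsmul, nsmul_eq_mul] at h
  exact ((isUnit_natCast_formalPeriodRing hN).mul_right_eq_zero).mp h

/-- `P` is torsion-free: multiplication by `N ≥ 1` is a bijection (unconditional form of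
`nsmul_bijective_of_integerDivision`). [folklore] -/
theorem nsmul_bijective {N : ℕ} (hN : 0 < N) :
    Function.Bijective fun x : FormalPeriodRing => N • x :=
  nsmul_bijective_of_integerDivision integerDivision_holds hN

/-- `P` has characteristic zero (`evalP` maps to `ℝ`). [folklore] -/
theorem charZero_formalPeriodRing : CharZero FormalPeriodRing :=
  evalP.charZero

end Units

/-! ## §1b Points of `Spec P` (realisation form of the crux)

In the language of the route's rank-2 crux (realisations `χ` of the rules into commutative
`ℚ`-algebras): the crux says exactly that the FIELD-valued realisations separate formal periods —
`x ≠ 0 ⇒ χ x ≠ 0` for some ring homomorphism `χ : P → K` into a field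
(`reducedPeriodRing_iff_fieldPoints_separate`). Consequence for planning: WITHOUT the crux the
route's mechanism still proves every double-shuffle relation "at all field points", i.e. modulo the
nilradical (`route_usage`); the crux is precisely the price of the last step `nil(P) = 0`. -/

section Points

/-- The crux ⇔ prime ideals separate the elements of `P`. [folklore] -/
theorem reducedPeriodRing_iff_primes_separate :
    ReducedPeriodRing ↔ ∀ x : FormalPeriodRing, x ≠ 0 →
      ∃ J : Ideal FormalPeriodRing, J.IsPrime ∧ x ∉ J := by
  rw [reducedPeriodRing_iff_isReduced]
  constructor
  · intro h x hx
    by_contra hcon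
    push Not at hcon
    exact hx (h.eq_zero x (nilpotent_iff_mem_prime.mpr hcon))
  · intro h
    refine ⟨fun x hx => ?_⟩
    by_contra hne
    obtain ⟨J, hJ, hxJ⟩ := h x hne
    exact hxJ (nilpotent_iff_mem_prime.mp hx J hJ)

/-- **Realisation form of the crux**: `P` is reduced iff ring homomorphisms to fields separate its
elements. (→: `x ∉ 𝔭`, then `P → P/𝔭 → Frac(P/𝔭)`; ←: the image of a nilpotent in a field is `0`.)
[folklore] -/
theorem reducedPeriodRing_iff_fieldPoints_separate :
    ReducedPeriodRing ↔ ∀ x : FormalPeriodRing, x ≠ 0 →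
      ∃ (K : Type) (_ : Field K) (χ : FormalPeriodRing →+* K), χ x ≠ 0 := by
  constructor
  · intro h x hx
    obtain ⟨J, hJ, hxJ⟩ := (reducedPeriodRing_iff_primes_separate.mp h) x hx
    haveI : J.IsPrime := hJ
    refine ⟨FractionRing (FormalPeriodRing ⧸ J), inferInstance,
      (algebraMap (FormalPeriodRing ⧸ J) (FractionRing (FormalPeriodRing ⧸ J))).comp
        (Ideal.Quotient.mk J), ?_⟩
    rw [RingHom.comp_apply, Ne, ← map_zero (algebraMap (FormalPeriodRing ⧸ J) (FractionRing (FormalPeriodRing ⧸ J))),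
      (IsFractionRing.injective (FormalPeriodRing ⧸ J) (FractionRing (FormalPeriodRing ⧸ J))).eq_iff,
      Ideal.Quotient.eq_zero_iff_mem]
    exact hxJ
  · intro h
    rw [reducedPeriodRing_iff_isReduced]
    refine ⟨fun x hx => ?_⟩
    by_contra hne
    obtain ⟨K, _, χ, hχ⟩ := h x hne
    exact hχ ((hx.map χ).eq_zero)

end Points


/-! ## §6c `P ≅ P_ℚ`: the crux is literally reducedness of the route's `ℚ`-algebra

`P_ℚ = ℚ ⊗_ℤ P` (`KZ.FormalPeriodAlgebra`) is the localisation of `P` at the non-zero integers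
(base change of `ℤ → ℚ`), and those are UNITS of `P` (§6b); hence `toPeriodAlgebra : P → P_ℚ` is a
ring isomorphism (`toPeriodAlgebra_bijective`) and
`IsReduced FormalPeriodAlgebra ↔ ReducedPeriodRing` (`isReduced_formalPeriodAlgebra_iff`). For the
prover of the lever: `FurushoOverReduced` may be applied to `R = FormalPeriodAlgebra` under the
crux with no further torsion/flatness argument. -/

section RationalAlgebra

open scoped TensorProduct

/-- The non-zero integers map to units of `P`. [folklore] -/
theorem algebraMapSubmonoid_int_le_isUnit :
    Algebra.algebraMapSubmonoid FormalPeriodRing (nonZeroDivisors ℤ) ≤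
      IsUnit.submonoid FormalPeriodRing := by
  rintro x ⟨z, hz, rfl⟩
  have hz0 : (z : ℤ) ≠ 0 := nonZeroDivisors.ne_zero hz
  have hu : IsUnit ((z.natAbs : ℕ) : FormalPeriodRing) :=
    isUnit_natCast_formalPeriodRing (Int.natAbs_pos.mpr hz0)
  change IsUnit (algebraMap ℤ FormalPeriodRing z)
  rw [algebraMap_int_eq, eq_intCast]
  rcases Int.natAbs_eq z with h | h
  · rw [h, Int.cast_natCast]; exact hu
  · rw [h, Int.cast_neg, Int.cast_natCast]; exact hu.neg

attribute [local instance] Algebra.TensorProduct.rightAlgebra in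
/-- `P_ℚ` is the localisation of `P` at (the image of) the non-zero integers. [folklore] -/
theorem isLocalization_formalPeriodAlgebra :
    IsLocalization (Algebra.algebraMapSubmonoid FormalPeriodRing (nonZeroDivisors ℤ))
      FormalPeriodAlgebra :=
  IsLocalization.tensorRight (R := ℤ) (S := FormalPeriodRing) ℚ (nonZeroDivisors ℤ)

attribute [local instance] Algebra.TensorProduct.rightAlgebra in
/-- **`P → P_ℚ` is bijective** (a localisation at units). [folklore] -/
theorem toPeriodAlgebra_bijective : Function.Bijective toPeriodAlgebra := by
  haveI := isLocalization_formalPeriodAlgebra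
  have h := (IsLocalization.atUnits FormalPeriodRing
    (Algebra.algebraMapSubmonoid FormalPeriodRing (nonZeroDivisors ℤ)) (S := FormalPeriodAlgebra)
    algebraMapSubmonoid_int_le_isUnit).bijective
  have hfun : ⇑(IsLocalization.atUnits FormalPeriodRing
      (Algebra.algebraMapSubmonoid FormalPeriodRing (nonZeroDivisors ℤ)) (S := FormalPeriodAlgebra)
      algebraMapSubmonoid_int_le_isUnit) = ⇑toPeriodAlgebra := by
    funext x
    rfl
  rwa [hfun] at h

/-- **`P_ℚ` is reduced iff the crux holds.** [folklore] -/
theorem isReduced_formalPeriodAlgebra_iff : IsReduced FormalPeriodAlgebra ↔ ReducedPeriodRing := by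
  rw [reducedPeriodRing_iff_isReduced]
  constructor
  · intro h
    exact isReduced_of_injective (toPeriodAlgebra : FormalPeriodRing →ₐ[ℤ] FormalPeriodAlgebra)
      toPeriodAlgebra_bijective.1
  · intro h
    let e : FormalPeriodRing ≃+* FormalPeriodAlgebra :=
      RingEquiv.ofBijective (toPeriodAlgebra : FormalPeriodRing →ₐ[ℤ] FormalPeriodAlgebra)
        toPeriodAlgebra_bijective
    exact isReduced_of_injective e.symm e.symm.injective

end RationalAlgebra


/-! ## §9 Lines on record (crux ideas filed under `Cruxes/ReducedPeriodRing/Ideas/`)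

**cartier-pullback-nilpotents-are-pi-torsion** (planner-cruxidea, round 1): reduce the crux to
`C⁺ := NilpotentsArePiTorsion` (every square-zero `c` is killed in `relations` by a power of the
disc `[π]`) plus `KZ.PiCancellation` (item 0540). Adversary's reading, recorded as lemmas:
* `C⁺` is implied by `KZ.PiLocalKernel` (item 0541) — nilpotents have `eval = 0` — so the line is
  "(a weakening of 0541) ∧ 0540 ⇒ X3", both conjuncts summit-grade items of route
  AyoubSpecialisation (`nilpotentsArePiTorsion_of_piLocalKernel`);
* `C⁺ ∧ PiCancellation ⇒ crux` indeed (`reducedPeriodRing_of_piTorsion_of_piCancellation`);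
* `C⁺` alone carries NO reducedness: in `ℚ × ℚ[ε]` with `t = (1,0)` every nilpotent is `t`-torsion
  (`t · nil = 0`, and `R[1/t] = ℚ` is reduced) while `R` is not reduced and `ev t ≠ 0`
  (`piTorsion_model_not_reduced`) — all the weight sits on `PiCancellation`, exactly the card's own
  "honest residual". Nothing in this file refutes the line. (Its printed input is exact:
  Huber–Müller-Stach, *Periods and Nori Motives*, 2015 draft, Rem. 12.2.4, p. 34 read: "X(M) is
  smooth because G(M) is a group scheme over a field of characteristic zero" — reducedness of the
  LOCALISED algebra `O(X(M))`; the effective/rules side is where `PiCancellation` enters.)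
* Its transfer hypothesis `hker` ("`γ c = 0 ⇒ c` is `[π]`-power torsion mod relations" for a
  multiplicative move-killing `γ` into a reduced ring) is, by `multiplicative_certificate_vanishes`,
  the ENTIRE content: any such `γ` already kills every square-zero class, so the line is exactly
  as strong as the faithfulness-mod-`[π]` of one rules-to-motives symbol map plus item 0540. -/

section Lines

/-- `C⁺` of the Cartier-pullback card: every square-zero element is `[π]`-power torsion modulo
relations. -/
def NilpotentsArePiTorsion : Prop :=
  ∀ c : FormalRep, c * c ∈ relations → ∃ N : ℕ, (fun x => of piRep * x)^[N] c ∈ relations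

/-- `C⁺` follows from `PiLocalKernel` (item 0541): a square-zero element evaluates to `0`. -/
theorem nilpotentsArePiTorsion_of_piLocalKernel (h : PiLocalKernel) : NilpotentsArePiTorsion :=
  fun c hc => h c (eval_eq_zero_of_sq_mem_relations hc)

/-- `C⁺ ∧ PiCancellation ⇒ crux` (peel the powers of `[π]` one at a time). -/
theorem reducedPeriodRing_of_piTorsion_of_piCancellation (h : NilpotentsArePiTorsion)
    (hπ : PiCancellation) : ReducedPeriodRing := by
  intro c hc
  obtain ⟨N, hN⟩ := h c hc
  induction N generalizing c with
  | zero => simpa using hN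
  | succ N ih =>
    rw [Function.iterate_succ_apply'] at hN
    exact ih c hc (hπ _ hN)

/-- **`C⁺` alone carries no reducedness**: a commutative ring with an evaluation character, an
element `t` of non-zero value annihilating every nilpotent (so "nilpotents are `t`-torsion" holds
with exponent `1`, and `R[1/t]` is reduced), which is NOT reduced — `ℚ × ℚ[ε]`, `t = (1, 0)`. -/
theorem piTorsion_model_not_reduced :
    ∃ (R : Type) (_ : CommRing R) (ev : R →+* ℚ) (t : R), ev t ≠ 0 ∧
      (∀ b : R, IsNilpotent b → t * b = 0) ∧ ¬ IsReduced R := by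
  refine ⟨ℚ × DualNumber ℚ, inferInstance, RingHom.fst ℚ (DualNumber ℚ), (1, 0), by simp, ?_, ?_⟩
  · rintro ⟨a, x⟩ ⟨n, hn⟩
    have ha : a ^ n = 0 := by
      have := congrArg Prod.fst hn
      simpa using this
    have ha0 : a = 0 := pow_eq_zero_iff'.mp ha |>.1
    ext <;> simp [ha0]
  · intro hred
    have hnil : IsNilpotent ((0, DualNumber.eps) : ℚ × DualNumber ℚ) :=
      ⟨2, by ext <;> simp [pow_two, DualNumber.eps_mul_eps]⟩
    have h0 := hred.eq_zero _ hnil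
    have := congrArg (fun p : ℚ × DualNumber ℚ => TrivSqZeroExt.snd p.2) h0
    simp at this

end Lines


/-! ## §1c The two halves of `Spec P`: Conjecture 1 = irreducibility ∧ reducedness (cycle 2)

Write `𝔨 := ker evalP` (a prime: `P/𝔨 ↪ ℝ`) and `𝔫 := nilradical P ⊆ 𝔨`. The kernel conjecture
`𝔨 = 0` splits EXACTLY as `KernelIsNil` (`𝔨 ⊆ 𝔫`: every numerically vanishing class is nilpotent;
⇔ `𝔫 = 𝔨`; ⇔ every prime contains `𝔨`, i.e. `Spec P` is irreducible with generic point the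
real-period point; ⇔ every FIELD-valued — indeed every reduced-valued — realisation `χ` of the
rules kills `𝔨`, i.e. `χ x` depends only on the VALUE of `x`) AND the crux (`𝔫 = 0`: field points
SEPARATE, §1b). The two halves are abstractly independent (`dualNumber_model`, `product_model`).
Reading for the route: FurushoPentagon's mechanism (pentagon + group-likeness ⇒ every
double-shuffle defect is nilpotent, Furusho 2011 Thm 1.2 at each field point) is an
IRREDUCIBILITY-half engine for specific elements; the crux is precisely the reducedness half, and
no transfer along realisations / no field-level theorem can substitute for it. Conversely, under
`KernelIsNil` alone every realisation into a reduced ring factors through `evalP(P) ⊆ ℝ`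
(`KernelIsNil.ker_evalP_le_ker`; in the exact shape of PentagonInKZ's hypotheses — an additive
`χ : FormalRep →+ R` killing `relations` and multiplicative — `KernelIsNil.realisation_eq_zero_of_eval_eq_zero`:
`eval c = 0 → χ c = 0` for reduced `R`), so e.g. the rank-2 crux PentagonInKZ restricted to REDUCED
targets would follow from Drinfeld's real pentagon (tree theorem `drinfeldAssociator_pentagon_holds`)
pushed along `ψ : evalP(P) → R` — the transport itself is not formalised here (needs the `NCSeries`
change-of-coefficients API); orientation: the realisation device adds nothing beyond values on the
irreducibility half, and everything beyond values on the reducedness half. MOTIVIC PRECEDENT: for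
Nori's formal period algebra `𝒫̃(M) = O(X(M))`, which is SMOOTH ("X(M) is smooth because G(M) is a
group scheme over a field of characteristic zero", Huber–Müller-Stach, *Periods and Nori Motives*,
2015 draft Part III, after Def. 12.2.3), the Grothendieck conjecture `ev` injective is equivalent to
"the point `ev_M` of `Spec 𝒫̃(M)` is a generic point, and `X(M)` connected" (loc. cit. Conj. 12.2.5
(1)⇔(2); Rem. 12.2.2: "Equivalently, we can conjecture that `𝒫̃(k)` is an integral domain and ev a
generic point"). On the RULES side smoothness is not available: its place in that equivalence is
taken exactly by the crux, and "ev generic on the reduction" is `KernelIsNil`.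
Landing copy: `Theorems/ReducedPeriodRing/Negative/SpecHalves.lean` (there `KernelIsNil` is written out). -/

section SpecHalves

/-- **The irreducibility half of Conjecture 1**: every formal combination of value `0` has a
NILPOTENT class in `P = FormalRep ⧸ relations` (`ker evalP ⊆ nilradical P`). -/
def KernelIsNil : Prop :=
  ∀ c : FormalRep, eval c = 0 → IsNilpotent (toFormalPeriod c)

/-- **Conjecture 1 = irreducibility ∧ reducedness**: the kernel form `eval c = 0 → c ∈ relations`
holds iff every value-zero class is nilpotent AND the crux `ReducedPeriodRing` holds. [folklore] -/
theorem kzKernelConjecture_iff_kernelIsNil_and_reduced :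
    KZKernelConjecture ↔ KernelIsNil ∧ ReducedPeriodRing := by
  constructor
  · intro h
    refine ⟨fun c hc => ?_, fun c hc => h c (eval_eq_zero_of_sq_mem_relations hc)⟩
    rw [toFormalPeriod_eq_zero_of_mem (h c hc)]
    exact IsNilpotent.zero
  · rintro ⟨hN, hR⟩ c hc
    exact route_usage hR (hN c hc)

/-- The summit itself is the conjunction of the two halves. [folklore] -/
theorem summit_iff_kernelIsNil_and_reduced :
    KontsevichZagierPeriods ↔ KernelIsNil ∧ ReducedPeriodRing :=
  KontsevichZagierPeriods_iff.trans
    (kzKernelConjecture_iff_isRational.symm.trans kzKernelConjecture_iff_kernelIsNil_and_reduced)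

/-- Under the crux, the summit is EXACTLY the irreducibility half (what remains to be proved once
`ReducedPeriodRing` is granted). [folklore] -/
theorem summit_iff_kernelIsNil_of_reduced (hR : ReducedPeriodRing) :
    KontsevichZagierPeriods ↔ KernelIsNil := by
  rw [summit_iff_kernelIsNil_and_reduced]
  exact ⟨fun h => h.1, fun h => ⟨h, hR⟩⟩

/-- Nilpotent formal periods have value `0` (`ℝ` is reduced): `nilradical P ≤ ker evalP`. [folklore] -/
theorem nilradical_le_ker_evalP : nilradical FormalPeriodRing ≤ RingHom.ker evalP := by
  intro x hx
  rw [RingHom.mem_ker]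
  exact ((mem_nilradical.mp hx).map evalP).eq_zero

/-- `KernelIsNil` says the nilradical of `P` IS the kernel of evaluation. [folklore] -/
theorem kernelIsNil_iff_nilradical_eq_ker :
    KernelIsNil ↔ nilradical FormalPeriodRing = RingHom.ker evalP := by
  constructor
  · intro h
    refine le_antisymm nilradical_le_ker_evalP fun x hx => ?_
    obtain ⟨c, rfl⟩ := toFormalPeriod_surjective x
    rw [RingHom.mem_ker, evalP_toFormalPeriod] at hx
    exact mem_nilradical.mpr (h c hx)
  · intro h c hc
    have hx : toFormalPeriod c ∈ RingHom.ker evalP := by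
      rw [RingHom.mem_ker, evalP_toFormalPeriod]; exact hc
    rw [← h] at hx
    exact mem_nilradical.mp hx

/-- `KernelIsNil` says every prime ideal of `P` contains `ker evalP`, i.e. `ker evalP` is the
unique minimal prime: `Spec P` is irreducible with generic point the real-period point. [folklore] -/
theorem kernelIsNil_iff_ker_le_primes :
    KernelIsNil ↔ ∀ J : Ideal FormalPeriodRing, J.IsPrime → RingHom.ker evalP ≤ J := by
  rw [kernelIsNil_iff_nilradical_eq_ker]
  constructor
  · intro h J hJ
    rw [← h]
    haveI := hJ
    exact nilradical_le_prime J
  · intro h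
    refine le_antisymm nilradical_le_ker_evalP ?_
    rw [nilradical_eq_sInf]
    exact le_sInf fun J hJ => h J hJ

/-- **The irreducibility half says the REDUCED formal period ring is already the ring of real
periods**: evaluation is injective on `P ⧸ nilradical P`. (The crux says `P` is its own
reduction; together: `evalP` injective.) [folklore] -/
theorem kernelIsNil_iff_injective_evalP_red :
    KernelIsNil ↔
      Function.Injective (Ideal.Quotient.lift (nilradical FormalPeriodRing) evalP
        (fun _ hx => RingHom.mem_ker.mp (nilradical_le_ker_evalP hx))) := by
  rw [kernelIsNil_iff_nilradical_eq_ker]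
  constructor
  · intro h
    exact RingHom.lift_injective_of_ker_le_ideal _ _ h.ge
  · intro h
    refine le_antisymm nilradical_le_ker_evalP fun x hx => ?_
    rw [← Ideal.Quotient.eq_zero_iff_mem]
    apply h
    rw [map_zero, Ideal.Quotient.lift_mk]
    exact RingHom.mem_ker.mp hx

/-- **Under `KernelIsNil` every realisation of the rules into a REDUCED ring factors through the
value**: `evalP x = 0 → χ x = 0` (the image of a nilpotent in a reduced ring is `0`). So on the
irreducibility half, "realisations `χ` of the Kontsevich–Zagier rules into reduced commutative
rings" (the device of the route's rank-2 crux PentagonInKZ) are nothing but ring homomorphisms out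
of the ring of real periods `evalP(P) ⊆ ℝ`. [folklore] -/
theorem KernelIsNil.ker_evalP_le_ker (h : KernelIsNil) {R : Type*} [CommRing R] [IsReduced R]
    (χ : FormalPeriodRing →+* R) : RingHom.ker evalP ≤ RingHom.ker χ := by
  intro x hx
  obtain ⟨c, rfl⟩ := toFormalPeriod_surjective x
  rw [RingHom.mem_ker, evalP_toFormalPeriod] at hx
  rw [RingHom.mem_ker]
  exact ((h c hx).map χ).eq_zero

/-- A realisation of the rules (additive, killing `relations`, multiplicative) takes the value
`(χ c)^(k+1)` on every formal combination whose class is `⟦c⟧^(k+1)`. [folklore] -/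
theorem realisation_apply_of_toFormalPeriod_eq_pow {R : Type*} [CommRing R] (χ : FormalRep →+ R)
    (hrel : ∀ c ∈ relations, χ c = 0) (hmul : ∀ a b : FormalRep, χ (a * b) = χ a * χ b)
    (c : FormalRep) :
    ∀ (k : ℕ) (d : FormalRep), toFormalPeriod d = toFormalPeriod c ^ (k + 1) → χ d = χ c ^ (k + 1) := by
  have hcongr : ∀ d d' : FormalRep, toFormalPeriod d = toFormalPeriod d' → χ d = χ d' := by
    intro d d' h
    have h0 : χ (d - d') = 0 := hrel _ (toFormalPeriod_eq_iff.mp h)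
    rwa [map_sub, sub_eq_zero] at h0
  intro k
  induction k with
  | zero =>
    intro d hd
    rw [zero_add, pow_one] at hd ⊢
    exact hcongr d c hd
  | succ k ih =>
    intro d hd
    obtain ⟨d', hd'⟩ := toFormalPeriod_surjective (toFormalPeriod c ^ (k + 1))
    have h1 : toFormalPeriod d = toFormalPeriod (c * d') := by
      rw [map_mul, hd', hd, ← pow_succ']
    rw [hcongr d _ h1, hmul, ih d' hd', ← pow_succ']

/-- **On the irreducibility half, realisations into REDUCED rings see only values**: if every
value-zero class is nilpotent, then every realisation `χ` of the Kontsevich–Zagier rules as in the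
route's rank-2 crux PentagonInKZ (additive, killing `KZ.relations`, multiplicative for the Fubini
product) with reduced target satisfies `eval c = 0 → χ c = 0`; so the `χ`-valued regularised MZV
series is the image of the REAL one under a ring map out of the ring of real periods, and e.g. the
pentagon at reduced targets is then Drinfeld's real pentagon transported (not formalised).
[folklore] -/
theorem KernelIsNil.realisation_eq_zero_of_eval_eq_zero (hK : KernelIsNil)
    {R : Type*} [CommRing R] [IsReduced R] (χ : FormalRep →+ R)
    (hrel : ∀ c ∈ relations, χ c = 0) (hmul : ∀ a b : FormalRep, χ (a * b) = χ a * χ b)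
    {c : FormalRep} (hc : eval c = 0) : χ c = 0 := by
  obtain ⟨n, hn⟩ := hK c hc
  cases n with
  | zero => rw [pow_zero] at hn; exact absurd hn one_ne_zero
  | succ k =>
    obtain ⟨d, hd⟩ := toFormalPeriod_surjective (toFormalPeriod c ^ (k + 1))
    have hdrel : d ∈ relations := by rw [← toFormalPeriod_eq_zero_iff, hd, hn]
    have hpow : χ c ^ (k + 1) = 0 := by
      rw [← realisation_apply_of_toFormalPeriod_eq_pow χ hrel hmul c k d hd]
      exact hrel d hdrel
    exact IsReduced.eq_zero _ ⟨k + 1, hpow⟩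

/-- **Realisation form of the irreducibility half**: `KernelIsNil` iff every FIELD-valued
realisation `χ : P → K` kills `ker evalP` (←: apply it to `P → Frac(P/𝔭)` for every prime `𝔭`).
Compare `reducedPeriodRing_iff_fieldPoints_separate` (`Negative/RingForms.lean`): the crux is the
complementary statement that field points SEPARATE elements. [folklore] -/
theorem kernelIsNil_iff_fieldPoints_factor :
    KernelIsNil ↔ ∀ (K : Type) [Field K] (χ : FormalPeriodRing →+* K) (x : FormalPeriodRing),
      evalP x = 0 → χ x = 0 := by
  constructor
  · intro h K _ χ x hx
    exact h.ker_evalP_le_ker χ (RingHom.mem_ker.mpr hx)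
  · intro h
    rw [kernelIsNil_iff_ker_le_primes]
    intro J hJ x hx
    haveI := hJ
    have h1 := h (FractionRing (FormalPeriodRing ⧸ J))
      ((algebraMap (FormalPeriodRing ⧸ J) (FractionRing (FormalPeriodRing ⧸ J))).comp
        (Ideal.Quotient.mk J)) x (RingHom.mem_ker.mp hx)
    rw [RingHom.comp_apply,
      ← map_zero (algebraMap (FormalPeriodRing ⧸ J) (FractionRing (FormalPeriodRing ⧸ J))),
      (IsFractionRing.injective (FormalPeriodRing ⧸ J) (FractionRing (FormalPeriodRing ⧸ J))).eq_iff,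
      Ideal.Quotient.eq_zero_iff_mem] at h1
    exact h1

/-- The two halves together, in realisation language: Conjecture 1 holds iff field-valued
realisations of the rules factor through the value AND separate formal periods. [folklore] -/
theorem kzKernelConjecture_iff_fieldPoints :
    KZKernelConjecture ↔
      (∀ (K : Type) [Field K] (χ : FormalPeriodRing →+* K) (x : FormalPeriodRing),
        evalP x = 0 → χ x = 0) ∧
      (∀ x : FormalPeriodRing, x ≠ 0 →
        ∃ (K : Type) (_ : Field K) (χ : FormalPeriodRing →+* K), χ x ≠ 0) := by
  rw [kzKernelConjecture_iff_kernelIsNil_and_reduced, kernelIsNil_iff_fieldPoints_factor,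
    reducedPeriodRing_iff_fieldPoints_separate]

/-! ### The two halves are abstractly independent -/

/-- **Irreducibility without reducedness**: a commutative ring with a surjective evaluation
character in which EVERY value-zero element is nilpotent (indeed square-zero) but which is not
reduced — the dual numbers `ℚ[ε]`, `ev` = standard part. [folklore] -/
theorem dualNumber_model :
    ∃ (R : Type) (_ : CommRing R) (ev : R →+* ℚ), Function.Surjective ev ∧
      (∀ x : R, ev x = 0 → x * x = 0) ∧ ¬ IsReduced R := by
  refine ⟨DualNumber ℚ, inferInstance, (TrivSqZeroExt.fstHom ℚ ℚ ℚ).toRingHom, ?_, ?_, ?_⟩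
  · intro q
    exact ⟨TrivSqZeroExt.inl q, by simp⟩
  · intro x hx
    have hx' : x.fst = 0 := by simpa using hx
    have hxe : x = TrivSqZeroExt.inr x.snd := by
      ext <;> simp [hx']
    rw [hxe]
    exact TrivSqZeroExt.inr_mul_inr ℚ x.snd x.snd
  · intro hred
    have hnil : IsNilpotent (DualNumber.eps : DualNumber ℚ) :=
      ⟨2, by rw [pow_two]; exact DualNumber.eps_mul_eps⟩
    have h0 := hred.eq_zero _ hnil
    have := congrArg TrivSqZeroExt.snd h0
    simp at this

/-- **Reducedness without irreducibility**: a REDUCED commutative ring with a surjective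
evaluation character and a value-zero element which is not nilpotent (it is idempotent) —
`ℚ × ℚ`, `ev = fst`, `x = (0, 1)`; here `Spec` has two points and the evaluation sees one. So the
crux alone implies no instance of the irreducibility half, and conversely. [folklore] -/
theorem product_model :
    ∃ (R : Type) (_ : CommRing R) (ev : R →+* ℚ) (x : R), Function.Surjective ev ∧
      IsReduced R ∧ ev x = 0 ∧ ¬ IsNilpotent x ∧ x * x = x := by
  refine ⟨ℚ × ℚ, inferInstance, RingHom.fst ℚ ℚ, (0, 1), ?_, inferInstance, by simp, ?_, by simp⟩
  · intro q
    exact ⟨(q, 0), by simp⟩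
  · rintro ⟨n, hn⟩
    have := congrArg Prod.snd hn
    simp at this

/-- **Idempotents are invisible to the crux**: a non-trivial idempotent `e` of `P` (`e² = e`,
`e ≠ 0, 1`) would refute the summit (`evalP e ∈ {0,1}` forces `e ∼ 0` or `e ∼ 1` under the
kernel conjecture) but is consistent with `ReducedPeriodRing` (`product_model`). Recorded as: under
the kernel conjecture `P` has only the trivial idempotents. [folklore] -/
theorem idempotent_trivial_of_kernel (hK : KZKernelConjecture) (e : FormalPeriodRing)
    (he : e * e = e) : e = 0 ∨ e = 1 := by
  have hinj := kzKernelConjecture_iff_injective_evalP.mp hK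
  have hv : evalP e * evalP e = evalP e := by rw [← map_mul, he]
  have hv' : evalP e = 0 ∨ evalP e = 1 := by
    have : evalP e * (evalP e - 1) = 0 := by rw [mul_sub, mul_one, hv, sub_self]
    rcases mul_eq_zero.mp this with h | h
    · exact Or.inl h
    · exact Or.inr (sub_eq_zero.mp h)
  rcases hv' with h | h
  · left; apply hinj; rw [h, map_zero]
  · right; apply hinj; rw [h, map_one]


end SpecHalves

/-! ## §8b The shape of a witness, sharpened: a NON-NEGATIVE PAIR (cycle 2)

Splitting the single signed witness `u` of §8 along the sign of its integrand: `¬ crux` iff two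
NON-NEGATIVE representations `a = [σ₊, f]`, `b = [σ₋, g]` of one dimension admit a move chain for
the AM–GM identity `a ⊠ a + b ⊠ b ∼ a ⊠ b + b ⊠ a` (four non-negative product representations,
values `A² + B² = 2AB`, so `A = B`) but none for `a ∼ b` (`not_reducedPeriodRing_iff_nonneg_pair`);
equivalently the crux is the rigidity `nonneg_pair_rigidity_iff`. A witness is thus an instance of
the two-representation conjecture FOR NON-NEGATIVE INTEGRANDS OF EQUAL VALUE which the calculus
settles one Fubini level up in the symmetric combination but not directly. VOLUME FORM
(`not_reducedPeriodRing_iff_volume_pair`, via the tree's PROVED Viu-Sos reduction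
`KZ.semiCanonicalReduction_holds`): a nilpotent is the same thing as two COMPACT `ℚ`-semialgebraic
bodies `A ⊂ ℝ^m`, `B ⊂ ℝ^{m'}` with non-empty interiors such that the rules prove
`vol(A×A) + vol(B×B) = vol(A×B) + vol(B×A)` but not `vol A = vol B` — the crux in the volume
language of Cresson–Viu-Sos. A single witness may be taken rational
(`not_reducedPeriodRing_iff_single_rational`). Landing copy:
`Theorems/ReducedPeriodRing/Negative/WitnessPairs.lean`. -/

section WitnessPairs

open MeasureTheory Set
open Literature.ModelTheory.ExponentialFields (IsSemialgebraic)

variable {n : ℕ}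

/-- The AM–GM combination is the square of the difference: `(a − b)² = a² + b² − (ab + ba)` in the
(non-commutative, non-associative) ring `FormalRep`. [folklore] -/
theorem sub_mul_sub_eq_amgm (a b : FormalRep) :
    (a - b) * (a - b) = a * a + b * b - (a * b + b * a) := by
  simp only [sub_mul, mul_sub]; abel

/-- **Explicit sign split**: every representation `r = [σ, f]` is equivalent to `[σ₊, f] − [σ₋, −f]`
with `σ₊ = {f ≥ 0}`, `σ₋ = {f < 0}` — two NON-NEGATIVE representations of the same dimension
(domain additivity + `[τ, h] + [τ, −h] ∈ relations`). [Kontsevich–Zagier 2001, §1.2 rule (1)] -/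
theorem exists_nonneg_pair_of (r : IntegralRep n) :
    ∃ a b : IntegralRep n, (∀ x ∈ a.domain, 0 ≤ a.integrand x) ∧
      (∀ x ∈ b.domain, 0 ≤ b.integrand x) ∧ of r - (of a - of b) ∈ relations := by
  set Sp : Set (Fin n → ℝ) := {x | x ∈ r.domain ∧ 0 ≤ r.integrand x} with hSp
  set Sm : Set (Fin n → ℝ) := {x | x ∈ r.domain ∧ r.integrand x < 0} with hSm
  have hSps : IsSemialgebraic ℚ Sp := isSemialgebraic_sep_integrand_nonneg r
  have hSms : IsSemialgebraic ℚ Sm := isSemialgebraic_sep_integrand_neg r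
  set rp : IntegralRep n := r.restrict Sp hSps (fun x hx => hx.1) with hrp
  set rm : IntegralRep n := r.restrict Sm hSms (fun x hx => hx.1) with hrm
  have hdisj : Sp ∩ Sm = ∅ := by
    rw [Set.eq_empty_iff_forall_notMem]
    rintro x ⟨hxp, hxm⟩
    exact absurd hxm.2 (not_lt.mpr hxp.2)
  have hsplit : of r - of rp - of rm ∈ domainAddRel := by
    refine ⟨n, r, rp, rm, ?_, ?_, fun _ _ => rfl, fun _ _ => rfl, rfl⟩
    · ext x
      simp only [hrp, hrm, IntegralRep.domain_restrict, mem_union, hSp, hSm, mem_setOf_eq]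
      constructor
      · intro hx
        rcases le_or_gt 0 (r.integrand x) with h | h
        · exact Or.inl ⟨hx, h⟩
        · exact Or.inr ⟨hx, h⟩
      · rintro (⟨hx, -⟩ | ⟨hx, -⟩) <;> exact hx
    · simp [hrp, hrm, hdisj]
  refine ⟨rp, rm.neg, fun x hx => hx.2, fun x hx => ?_, ?_⟩
  · have hx' : r.integrand x < 0 := hx.2
    simp only [IntegralRep.integrand_neg, Pi.neg_apply, hrm, IntegralRep.integrand_restrict]
    linarith
  · have h1 := domainAddRel_subset_relations hsplit
    have h2 := of_add_of_neg_mem_relations rm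
    have heq : of r - (of rp - of rm.neg) = (of r - of rp - of rm) + (of rm + of rm.neg) := by abel
    rw [heq]
    exact relations.add_mem h1 h2

/-- **Normal form of a witness: a non-negative pair.** `¬ ReducedPeriodRing` iff two NON-NEGATIVE
representations `a, b` of the same dimension have `a ⊠ a + b ⊠ b ∼ a ⊠ b + b ⊠ a` provable by the
moves while `a ∼ b` is not. (→: split the single signed witness of
`not_reducedPeriodRing_iff_single` along the sign of its integrand; ←: `(a − b)² = a² + b² − (ab + ba)`.)
[folklore] -/
theorem not_reducedPeriodRing_iff_nonneg_pair :
    ¬ ReducedPeriodRing ↔ ∃ (N : ℕ) (a b : IntegralRep N),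
      (∀ x ∈ a.domain, 0 ≤ a.integrand x) ∧ (∀ x ∈ b.domain, 0 ≤ b.integrand x) ∧
      of a * of a + of b * of b - (of a * of b + of b * of a) ∈ relations ∧ ¬ Equivalent a b := by
  constructor
  · intro h
    obtain ⟨N, u, hsq, hne⟩ := not_reducedPeriodRing_iff_single.mp h
    obtain ⟨a, b, ha, hb, hu⟩ := exists_nonneg_pair_of u
    refine ⟨N, a, b, ha, hb, ?_, fun he => hne ?_⟩
    · have hd : (of a - of b) - of u ∈ relations := by simpa using relations.neg_mem hu
      have h1 := mul_sub_mul_mem_relations hd hd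
      rw [of_mul_of] at h1
      have h2 : (of a - of b) * (of a - of b) ∈ relations := by
        have := relations.add_mem h1 hsq
        simpa using this
      rwa [sub_mul_sub_eq_amgm] at h2
    · have : of u = (of u - (of a - of b)) + (of a - of b) := by abel
      rw [this]
      exact relations.add_mem hu he
  · rintro ⟨N, a, b, -, -, hsq, hne⟩ h
    exact hne (h _ (by rw [sub_mul_sub_eq_amgm]; exact hsq))

/-- **The crux as AM–GM rigidity for non-negative PAIRS** (sharpens `reducedPeriodRing_iff_amgm_cone`
of `Negative/PositiveCone.lean` from sums of non-negative representations to single ones):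
`ReducedPeriodRing` iff for all non-negative representations `a, b` of a common dimension, a move
chain `a ⊠ a + b ⊠ b ∼ a ⊠ b + b ⊠ a` yields a move chain `a ∼ b`. [folklore] -/
theorem nonneg_pair_rigidity_iff :
    ReducedPeriodRing ↔ ∀ (N : ℕ) (a b : IntegralRep N),
      (∀ x ∈ a.domain, 0 ≤ a.integrand x) → (∀ x ∈ b.domain, 0 ≤ b.integrand x) →
      of a * of a + of b * of b - (of a * of b + of b * of a) ∈ relations → Equivalent a b := by
  constructor
  · intro h N a b _ _ hsq
    exact h _ (by rw [sub_mul_sub_eq_amgm]; exact hsq)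
  · intro h
    by_contra hc
    obtain ⟨N, a, b, ha, hb, hsq, hne⟩ := not_reducedPeriodRing_iff_nonneg_pair.mp hc
    exact hne (h N a b ha hb hsq)

/-- In a witness pair the two representations have the SAME VALUE (`(A − B)² = 0` in `ℝ`), so the
pair is in particular an instance of the two-representation conjecture for non-negative
integrands; but the converse fails to bite: equal values alone give no move chain for the square.
[folklore] -/
theorem value_eq_of_amgm_mem_relations {N : ℕ} (a b : IntegralRep N)
    (hsq : of a * of a + of b * of b - (of a * of b + of b * of a) ∈ relations) :
    a.value = b.value := by
  have h0 : eval ((of a - of b) * (of a - of b)) = 0 := by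
    rw [sub_mul_sub_eq_amgm]; exact relations_le_ker_eval_holds hsq
  rw [eval_mul', mul_self_eq_zero, map_sub, eval_of, eval_of, sub_eq_zero] at h0
  exact h0


/-! ### Rational and volume normal forms -/

/-- **A single witness of KZ's literal shape**: `¬ ReducedPeriodRing` iff some representation `u`
with RATIONAL integrand (`KZ.IntegralRep.IsRational`) has `[u ⊠ u] ∈ relations`, `[u] ∉ relations`
(`KZ.exists_isRational_equivalent`: algebraic integrands reduce to rational ones by the moves).
[Kontsevich–Zagier 2001, §1.1] -/
theorem not_reducedPeriodRing_iff_single_rational :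
    ¬ ReducedPeriodRing ↔
      ∃ (N : ℕ) (u : IntegralRep N), u.IsRational ∧ of (u.prod u) ∈ relations ∧ of u ∉ relations := by
  constructor
  · intro h
    obtain ⟨N, u, hsq, hne⟩ := not_reducedPeriodRing_iff_single.mp h
    obtain ⟨M, R, hR, huR⟩ := exists_isRational_equivalent_holds u
    refine ⟨M, R, hR, ?_, fun hR0 => hne ?_⟩
    · have hd : of R - of u ∈ relations := by simpa using relations.neg_mem huR
      have h1 := mul_sub_mul_mem_relations hd hd
      rw [of_mul_of, of_mul_of] at h1
      have := relations.add_mem h1 hsq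
      simpa using this
    · have := relations.add_mem huR hR0
      simpa using this
  · rintro ⟨N, u, -, hsq, hne⟩ h
    exact hne (h _ (by rw [of_mul_of]; exact hsq))

/-- A representation of POSITIVE value is equivalent to the volume of a compact `ℚ`-semialgebraic
body with non-empty interior (Viu-Sos' semi-canonical reduction, tree theorem
`KZ.semiCanonicalReduction_holds`, after `KZ.exists_isRational_equivalent`). [Viu-Sos, IJNT 17
(2021), Thm. 1.1] -/
theorem exists_compactVolume_of_value_pos (r : IntegralRep n) (h : 0 < r.value) :
    ∃ (m : ℕ) (K : IntegralRep m), IsCompact K.domain ∧ (interior K.domain).Nonempty ∧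
      (∀ z ∈ K.domain, K.integrand z = 1) ∧ of r - of K ∈ relations := by
  obtain ⟨M, R, hR, hrR⟩ := exists_isRational_equivalent_holds r
  have hRv : R.value = r.value := (Equivalent.value_eq_holds hrR).symm
  obtain ⟨m, K, -, -, hKc, hKi, hK1, hKpos, -⟩ :=
    semiCanonicalReduction_holds R hR (by rw [hRv]; exact h.ne')
  refine ⟨m, K, hKc, hKi, hK1, ?_⟩
  have h1 : of R - of K ∈ relations := hKpos (by rw [hRv]; exact h)
  have := relations.add_mem hrR h1
  simpa using this

/-- **Volume form of the crux.** `¬ ReducedPeriodRing` iff there are two COMPACT `ℚ`-semialgebraic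
bodies `A ⊂ ℝ^m`, `B ⊂ ℝ^{m'}` with non-empty interiors (volume representations `[A, 1]`, `[B, 1]`;
equal volumes by `value_eq_of_amgm_mem_relations`) such that the rules PROVE
`vol(A × A) + vol(B × B) = vol(A × B) + vol(B × A)` — a move chain between volumes of compact bodies
in `ℝ^{2m}`, `ℝ^{2m'}`, `ℝ^{m+m'}` — but do NOT prove `vol A = vol B`. (→: the non-negative pair of
`not_reducedPeriodRing_iff_nonneg_pair` has a positive common value, for value `0` would put both
members in `relations`; reduce each member to a compact volume and transport the chain.)
[Viu-Sos, IJNT 17 (2021), Thm. 1.1; Cresson–Viu-Sos, JTNB 34 (2022), §1] -/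
theorem not_reducedPeriodRing_iff_volume_pair :
    ¬ ReducedPeriodRing ↔ ∃ (m m' : ℕ) (A : IntegralRep m) (B : IntegralRep m'),
      IsCompact A.domain ∧ (interior A.domain).Nonempty ∧ (∀ z ∈ A.domain, A.integrand z = 1) ∧
      IsCompact B.domain ∧ (interior B.domain).Nonempty ∧ (∀ z ∈ B.domain, B.integrand z = 1) ∧
      of A * of A + of B * of B - (of A * of B + of B * of A) ∈ relations ∧ ¬ Equivalent A B := by
  constructor
  · intro h
    obtain ⟨N, a, b, ha, hb, hsq, hne⟩ := not_reducedPeriodRing_iff_nonneg_pair.mp h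
    have hv : a.value = b.value := value_eq_of_amgm_mem_relations a b hsq
    have hpos : 0 < a.value := by
      have h0 : 0 ≤ a.value := setIntegral_nonneg (IntegralRep.measurableSet_domain_holds a) ha
      rcases h0.lt_or_eq with hlt | heq
      · exact hlt
      · exfalso
        apply hne
        have ha0 : of a ∈ relations := of_mem_relations_of_nonneg_of_value_eq_zero a ha heq.symm
        have hb0 : of b ∈ relations :=
          of_mem_relations_of_nonneg_of_value_eq_zero b hb (by rw [← hv]; exact heq.symm)
        exact relations.sub_mem ha0 hb0
    obtain ⟨m, A, hAc, hAi, hA1, haA⟩ := exists_compactVolume_of_value_pos a hpos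
    obtain ⟨m', B, hBc, hBi, hB1, hbB⟩ := exists_compactVolume_of_value_pos b (hv ▸ hpos)
    refine ⟨m, m', A, B, hAc, hAi, hA1, hBc, hBi, hB1, ?_, fun hAB => hne ?_⟩
    · have hd : (of A - of B) - (of a - of b) ∈ relations := by
        have heq : (of A - of B) - (of a - of b) = -(of a - of A) + (of b - of B) := by abel
        rw [heq]
        exact relations.add_mem (relations.neg_mem haA) hbB
      have h1 := mul_sub_mul_mem_relations hd hd
      have hsq' : (of a - of b) * (of a - of b) ∈ relations := by
        rw [sub_mul_sub_eq_amgm]; exact hsq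
      have h2 := relations.add_mem h1 hsq'
      rw [sub_add_cancel, sub_mul_sub_eq_amgm] at h2
      exact h2
    · have heq : of a - of b = (of a - of A) + (of A - of B) - (of b - of B) := by abel
      show of a - of b ∈ relations
      rw [heq]
      exact relations.sub_mem (relations.add_mem haA hAB) hbB
  · rintro ⟨m, m', A, B, -, -, -, -, -, -, hsq, hne⟩ h
    exact hne (h _ (by rw [sub_mul_sub_eq_amgm]; exact hsq))



/-- **A volume-pair witness must leave the plane, unless `PlanarAreas` fails**: under the shared
item `PlanarAreas` (stmt-KontsevichZagierPeriods-0117, routes LowDimension / HodgeLevel /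
SymplecticScissors: two planar integrand-`1` representations of equal area are KZ-equivalent —
written out as the hypothesis) no witness pair has both bodies planar, since the AM–GM chain forces
equal areas (`value_eq_of_amgm_mem_relations`). [folklore] -/
theorem no_planar_volume_witness
    (hPA : ∀ (r r' : IntegralRep 2), (∀ p ∈ r.domain, r.integrand p = 1) →
      (∀ p ∈ r'.domain, r'.integrand p = 1) → r.value = r'.value → Equivalent r r')
    (A B : IntegralRep 2) (hA1 : ∀ z ∈ A.domain, A.integrand z = 1)
    (hB1 : ∀ z ∈ B.domain, B.integrand z = 1)
    (hsq : of A * of A + of B * of B - (of A * of B + of B * of A) ∈ relations) :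
    Equivalent A B :=
  hPA A B hA1 hB1 (value_eq_of_amgm_mem_relations A B hsq)


end WitnessPairs

/-! ## §9b Load-bearing anatomy of the PICKED line (skeleton `c5e5bca5…`, cycle 2)

The registered skeleton (line `cartier-pullback-nilpotents-are-pi-torsion` in the sharpened form
of TRIAGE-r1-2 §F; stubs `stub_cubeCompilation`, `stub_cubeProduct`, `stub_stokesCalibration`,
`stub_movesAreStokesModPi`, `stub_ayoubLocalisedReduced`, `stub_piCalibration`,
`stub_piCancellation`) has the abstract shape: a ring map `Φ : A → P` (`CubeProduct` +
`StokesCalibration` = well-definedness/multiplicativity of the cube realisation of Ayoub's REAL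
effective ring `A`), SURJECTIVE (`CubeCompilation`), with `ker Φ ⊆ t^∞`-torsion
(`MovesAreStokesModPi`, `t = g_π`), `A[1/t]` reduced (`AyoubLocalisedReduced`), `Φ t = ⟦[disc]⟧`
(`PiCalibration`) regular (`PiCancellation`). Certified here as commutative algebra: the transfer
is valid (`isReduced_of_transfer`; without regularity it yields exactly `C⁺`,
`nil_torsion_of_transfer`; `reducedPeriodRing_of_transfer` concludes the crux BY NAME), and EACH
of surjectivity / kernel control / localised reducedness / regularity is load-bearing
(`transfer_needs_*`: drop one, get a non-reduced target). Adversary's verdict on the stubs (no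
skeleton text available to this seat — the planner's `crux write` was refused and the evidence
store is not mounted here; names from the ledger): none is cheaply killable —
`PiCancellation` (0540) is summit-implied; `PiCalibration` is a value-true move-chain claim
(`∫₀¹ 6 dz/√(4 − z²) = 6 arcsin(1/2) = π = value [disc]`; Weierstrass + Möbius CoVs);
`StokesCalibration` / `CubeProduct` are Newton–Leibniz + reindexing instances; `CubeCompilation`
has no value-level obstruction (every real period is a cube integral of such a germ, Ayoub) and is
"surjectivity is easy" (Ayoub 2014 Rem. 12) up to the real/analytic-beyond-the-closed-cube
strengthening flagged in TRIAGE-r1-1 N5; `MovesAreStokesModPi` is predicted by inputs of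
THEOREM type carrying no period-conjecture content — soundness of an additive Nori symbol
normalised on cube classes (the construction of Huber–Müller-Stach 2017 §12.2; in the tree the
POSITED `KZ.NoriSymbolData`, itself a thesis of routes VeryGoodTransfer / HodgeColevel, not in
print as a theorem for the semialgebraic rules) + Ayoub 2014 Prop. 11
(`Φ F ∈ relations ⇒ taut F = 0 in 𝒫_Nori ≅ A_ℂ[1/2πi] ⇒ (2πi)^K F ∈ Stokes span`, then real
descent) — so the CONJECTURAL weight of the line sits on `PiCancellation` (period-conjecture
type) and on symbol soundness (comparison type), matching `transfer_needs_regular` /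
`piTorsion_model_not_reduced` and `transfer_needs_kernel_control`. Landing copy:
`Theorems/ReducedPeriodRing/Negative/LineLoadBearing.lean`. -/

section Transfer

variable {A R : Type*} [CommRing A] [CommRing R]

/-- **The transfer behind the line, without regularity**: a surjective ring map `Φ : A → R` whose
kernel is `t`-power torsion, from a ring whose nilpotents are `t`-power torsion (`⇔ A[1/t]`
reduced), makes every nilpotent of `R` a `Φ t`-power-torsion element. [folklore] -/
theorem nil_torsion_of_transfer (Φ : A →+* R) (t : A) (hsurj : Function.Surjective Φ)
    (hker : ∀ a : A, Φ a = 0 → ∃ N : ℕ, t ^ N * a = 0)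
    (hred : ∀ a : A, IsNilpotent a → ∃ N : ℕ, t ^ N * a = 0)
    (x : R) (hx : IsNilpotent x) : ∃ N : ℕ, Φ t ^ N * x = 0 := by
  obtain ⟨a, rfl⟩ := hsurj x
  obtain ⟨n, hn⟩ := hx
  rw [← map_pow] at hn
  obtain ⟨N, hN⟩ := hker _ hn
  have hnil : IsNilpotent (t ^ N * a) := by
    refine ⟨n + 1, ?_⟩
    calc (t ^ N * a) ^ (n + 1) = (t ^ N) ^ n * (a * (t ^ N * a ^ n)) := by ring
      _ = 0 := by rw [hN]; ring
  obtain ⟨M, hM⟩ := hred _ hnil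
  refine ⟨M + N, ?_⟩
  have := congrArg Φ hM
  rwa [map_mul, map_mul, map_pow, map_pow, map_zero, ← mul_assoc, ← pow_add] at this

/-- **The transfer behind the line**: if moreover `Φ t` is regular in `R`, then `R` is reduced.
[folklore] -/
theorem isReduced_of_transfer (Φ : A →+* R) (t : A) (hsurj : Function.Surjective Φ)
    (hker : ∀ a : A, Φ a = 0 → ∃ N : ℕ, t ^ N * a = 0)
    (hred : ∀ a : A, IsNilpotent a → ∃ N : ℕ, t ^ N * a = 0)
    (hreg : ∀ y : R, Φ t * y = 0 → y = 0) : IsReduced R := by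
  refine ⟨fun x hx => ?_⟩
  obtain ⟨N, hN⟩ := nil_torsion_of_transfer Φ t hsurj hker hred x hx
  induction N with
  | zero => simpa using hN
  | succ N ih => exact ih (hreg _ (by rw [← mul_assoc, ← pow_succ']; exact hN))

/-- The localised-reducedness input in Mathlib's spelling: if `A[1/t]` is reduced then nilpotents
of `A` are `t`-power torsion. [folklore] -/
theorem torsion_of_isReduced_away (t : A) [IsReduced (Localization.Away t)] (a : A)
    (ha : IsNilpotent a) : ∃ N : ℕ, t ^ N * a = 0 := by
  have h0 : algebraMap A (Localization.Away t) a = 0 :=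
    (ha.map (algebraMap A (Localization.Away t))).eq_zero
  rw [IsLocalization.map_eq_zero_iff (Submonoid.powers t)] at h0
  obtain ⟨⟨m, ⟨N, rfl⟩⟩, hm⟩ := h0
  exact ⟨N, by simpa using hm⟩

/-- **The line's deciding step against the route file**: a transfer datum onto
`P = KZ.FormalPeriodRing` with `Φ t` regular proves the crux `ReducedPeriodRing` by name.
(In the skeleton: `Φ` = cube realisation of Ayoub's real effective ring, `t = g_π`,
`Φ t = ⟦[disc]⟧`, regularity = `KZ.PiCancellation`.) [folklore] -/
theorem reducedPeriodRing_of_transfer {A : Type*} [CommRing A] (Φ : A →+* FormalPeriodRing) (t : A)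
    (hsurj : Function.Surjective Φ) (hker : ∀ a : A, Φ a = 0 → ∃ N : ℕ, t ^ N * a = 0)
    [IsReduced (Localization.Away t)] (hreg : ∀ y : FormalPeriodRing, Φ t * y = 0 → y = 0) :
    ReducedPeriodRing :=
  reducedPeriodRing_iff_isReduced.mpr
    (isReduced_of_transfer Φ t hsurj hker (torsion_of_isReduced_away t) hreg)

end Transfer

/-! ### Each input is load-bearing (drop-one models) -/

/-- The dual numbers `ℚ[ε]` are not reduced. [folklore] -/
theorem not_isReduced_dualNumber : ¬ IsReduced (DualNumber ℚ) := by
  intro hred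
  have hnil : IsNilpotent (DualNumber.eps : DualNumber ℚ) :=
    ⟨2, by rw [pow_two]; exact DualNumber.eps_mul_eps⟩
  have h0 := hred.eq_zero _ hnil
  have := congrArg TrivSqZeroExt.snd h0
  simp at this

/-- **`CubeCompilation` (surjectivity) is load-bearing**: `ℚ ↪ ℚ[ε]`, `t = 1` — injective (so
kernel control holds), source reduced, `Φ t = 1` regular, target not reduced. [folklore] -/
theorem transfer_needs_surjective :
    ∃ (A R : Type) (_ : CommRing A) (_ : CommRing R) (Φ : A →+* R) (t : A),
      (∀ a : A, Φ a = 0 → ∃ N : ℕ, t ^ N * a = 0) ∧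
      (∀ a : A, IsNilpotent a → ∃ N : ℕ, t ^ N * a = 0) ∧
      (∀ y : R, Φ t * y = 0 → y = 0) ∧ ¬ IsReduced R := by
  refine ⟨ℚ, DualNumber ℚ, inferInstance, inferInstance, algebraMap ℚ (DualNumber ℚ), 1,
    ?_, ?_, ?_, not_isReduced_dualNumber⟩
  · intro a ha
    have h0 : a = 0 := by
      have h := congrArg TrivSqZeroExt.fst ha
      simpa [TrivSqZeroExt.algebraMap_eq_inl] using h
    exact ⟨0, by simp [h0]⟩
  · intro a ha
    exact ⟨0, by simpa using ha.eq_zero⟩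
  · intro y hy
    simpa using hy

/-- **`MovesAreStokesModPi` (kernel control) is load-bearing**: `ℚ[X] ↠ ℚ[ε]`, `X ↦ ε`, `t = 1` —
surjective, source reduced (a domain), `Φ t = 1` regular, target not reduced; the kernel `(X²)` is
not torsion. [folklore] -/
theorem transfer_needs_kernel_control :
    ∃ (A R : Type) (_ : CommRing A) (_ : CommRing R) (Φ : A →+* R) (t : A),
      Function.Surjective Φ ∧
      (∀ a : A, IsNilpotent a → ∃ N : ℕ, t ^ N * a = 0) ∧
      (∀ y : R, Φ t * y = 0 → y = 0) ∧ ¬ IsReduced R := by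
  refine ⟨Polynomial ℚ, DualNumber ℚ, inferInstance, inferInstance,
    (Polynomial.aeval (R := ℚ) (DualNumber.eps : DualNumber ℚ)).toRingHom, 1, ?_, ?_, ?_,
    not_isReduced_dualNumber⟩
  · intro y
    refine ⟨Polynomial.C y.fst + Polynomial.C y.snd * Polynomial.X, ?_⟩
    change Polynomial.aeval DualNumber.eps (Polynomial.C y.fst + Polynomial.C y.snd * Polynomial.X) = y
    rw [map_add, map_mul, Polynomial.aeval_C, Polynomial.aeval_C, Polynomial.aeval_X]
    ext <;> simp [Algebra.algebraMap_eq_smul_one]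
  · intro a ha
    exact ⟨0, by simpa using ha.eq_zero⟩
  · intro y hy
    simpa using hy

/-- **`AyoubLocalisedReduced` is load-bearing**: the identity of `ℚ[ε]`, `t = 1` — surjective,
kernel control trivial, `Φ t = 1` regular, target not reduced (the source's nilpotent `ε` is not
`1`-power torsion). [folklore] -/
theorem transfer_needs_localised_reduced :
    ∃ (A R : Type) (_ : CommRing A) (_ : CommRing R) (Φ : A →+* R) (t : A),
      Function.Surjective Φ ∧
      (∀ a : A, Φ a = 0 → ∃ N : ℕ, t ^ N * a = 0) ∧
      (∀ y : R, Φ t * y = 0 → y = 0) ∧ ¬ IsReduced R := by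
  refine ⟨DualNumber ℚ, DualNumber ℚ, inferInstance, inferInstance, RingHom.id _, 1,
    Function.surjective_id, ?_, ?_, not_isReduced_dualNumber⟩
  · intro a ha
    exact ⟨0, by simpa using ha⟩
  · intro y hy
    simpa using hy

/-- **`PiCancellation` (regularity of `Φ t`) is load-bearing**: the identity of `ℚ × ℚ[ε]`,
`t = (1, 0)` — surjective, kernel control trivial, nilpotents `(0, bε)` ARE `t`-torsion (so the
localised ring `ℚ` is reduced), yet the target is not reduced: all the weight sits on regularity
of the disc class, exactly as in `piTorsion_model_not_reduced` of the crux workfile. [folklore] -/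
theorem transfer_needs_regular :
    ∃ (A R : Type) (_ : CommRing A) (_ : CommRing R) (Φ : A →+* R) (t : A),
      Function.Surjective Φ ∧
      (∀ a : A, Φ a = 0 → ∃ N : ℕ, t ^ N * a = 0) ∧
      (∀ a : A, IsNilpotent a → ∃ N : ℕ, t ^ N * a = 0) ∧ ¬ IsReduced R := by
  refine ⟨ℚ × DualNumber ℚ, ℚ × DualNumber ℚ, inferInstance, inferInstance, RingHom.id _, (1, 0),
    Function.surjective_id, ?_, ?_, ?_⟩
  · intro a ha
    exact ⟨0, by simpa using ha⟩
  · rintro ⟨a, x⟩ ⟨n, hn⟩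
    have ha : a ^ n = 0 := by
      have := congrArg Prod.fst hn
      simpa using this
    have ha0 : a = 0 := pow_eq_zero_iff'.mp ha |>.1
    refine ⟨1, ?_⟩
    ext <;> simp [ha0]
  · intro hred
    have hnil : IsNilpotent ((0, DualNumber.eps) : ℚ × DualNumber ℚ) :=
      ⟨2, by ext <;> simp [pow_two, DualNumber.eps_mul_eps]⟩
    have h0 := hred.eq_zero _ hnil
    have := congrArg (fun p : ℚ × DualNumber ℚ => TrivSqZeroExt.snd p.2) h0
    simp at this

/-! ### The sibling shadow "no zero-divisors" is also short of the summit, abstractly -/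

/-- A DOMAIN with a surjective evaluation character which is NOT injective: `ℝ[X] → ℝ`, `X ↦ 0`.
So "`P` is a domain" (which implies the crux and `PiCancellation` for every non-zero class) does
not abstractly give the kernel conjecture either. [folklore] -/
theorem domain_model_not_injective :
    ∃ (R : Type) (_ : CommRing R) (_ : IsDomain R) (ev : R →+* ℝ),
      Function.Surjective ev ∧ ¬ Function.Injective ev := by
  refine ⟨Polynomial ℝ, inferInstance, inferInstance, Polynomial.evalRingHom 0, ?_, ?_⟩
  · intro a
    exact ⟨Polynomial.C a, by simp⟩
  · intro hinj
    have h : Polynomial.evalRingHom 0 (Polynomial.X : Polynomial ℝ) = Polynomial.evalRingHom 0 0 := by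
      simp
    exact Polynomial.X_ne_zero (hinj h)


/-! ## §1d Lattice of shadows across routes (cycle 2)

`KernelIsNil ∧ C⁺ ⇒ PiLocalKernel` (item 0541 of route AyoubSpecialisation); with §9
(`PiLocalKernel ⇒ C⁺`, `C⁺ ∧ PiCancellation ⇒ crux`) and §1c
(`KZKernelConjecture ⇔ KernelIsNil ∧ crux`; also `⇔ PiLocalKernel ∧ PiCancellation`, the
AyoubSpecialisation assembly), the two routes cut the summit along different seams — (reduced) ×
(irreducible) here, ([π]-regular) × (kernel is [π]^∞-torsion) there — and the line's `C⁺`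
(`IsReduced P[1/π]`) is the common currency between the seams. Workfile only (conditional
positives of another route's item are not landed). -/

section Lattice

/-- Ring lemma: if every SQUARE-zero element is `t`-power torsion then every nilpotent is
(strong induction on the nilpotency order, halving it). [folklore] -/
theorem pow_torsion_of_sq_torsion {R : Type*} [CommRing R] (t : R)
    (h : ∀ y : R, y * y = 0 → ∃ N : ℕ, t ^ N * y = 0) :
    ∀ (n : ℕ) (x : R), x ^ n = 0 → ∃ N : ℕ, t ^ N * x = 0 := by
  intro n
  induction n using Nat.strong_induction_on with
  | _ n ih =>
    intro x hx
    rcases Nat.lt_or_ge n 2 with hn | hn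
    · interval_cases n
      · have h1 : (1 : R) = 0 := by simpa using hx
        exact ⟨0, by rw [pow_zero, one_mul, ← one_mul x, h1, zero_mul]⟩
      · exact ⟨0, by simpa using hx⟩
    · -- `m = (n + 1) / 2`: `2m ≥ n`, `1 ≤ m < n`
      set m := (n + 1) / 2 with hm
      have h2m : n ≤ 2 * m := by omega
      have hm1 : 1 ≤ m := by omega
      have hmn : m < n := by omega
      have hy : x ^ m * x ^ m = 0 := by
        rw [← pow_add, ← two_mul]
        obtain ⟨k, hk⟩ := Nat.exists_eq_add_of_le h2m
        rw [hk, pow_add, hx, zero_mul]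
      obtain ⟨N, hN⟩ := h _ hy
      have hz : (t ^ N * x) ^ m = 0 := by
        obtain ⟨k, hk⟩ := Nat.exists_eq_add_of_le hm1
        have hx' : t ^ N * x ^ (1 + k) = 0 := by rw [← hk]; exact hN
        have heq : (t ^ N * x) ^ (1 + k) = t ^ (N * k) * (t ^ N * x ^ (1 + k)) := by ring
        rw [hk, heq, hx', mul_zero]
      obtain ⟨M, hM⟩ := ih m hmn _ hz
      exact ⟨M + N, by rw [pow_add, mul_assoc]; exact hM⟩

/-- The class of the iterate `[π] * ([π] * ⋯ c)` is `⟦π⟧^N · ⟦c⟧`. [folklore] -/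
theorem toFormalPeriod_iterate_piRep_mul (N : ℕ) (c : FormalRep) :
    toFormalPeriod ((fun x => of piRep * x)^[N] c) =
      toFormalPeriod (of piRep) ^ N * toFormalPeriod c := by
  induction N with
  | zero => simp
  | succ N ih => rw [Function.iterate_succ_apply', map_mul, ih, pow_succ', mul_assoc]

/-- **Lattice of shadows across routes**: the irreducibility half `KernelIsNil` together with the
picked line's `C⁺` (square-zero classes are `[π]`-power torsion) gives route AyoubSpecialisation's
crux `KZ.PiLocalKernel` (item 0541: value-zero classes are `[π]`-power torsion). With
`PiLocalKernel ⇒ C⁺` and `C⁺ ∧ PiCancellation ⇒ ReducedPeriodRing` (crux workfile §9) and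
`PiLocalKernel ∧ PiCancellation ⇔ KZKernelConjecture ⇔ KernelIsNil ∧ ReducedPeriodRing`, the two
routes split the summit along different seams joined by `C⁺`. [folklore] -/
theorem piLocalKernel_of_kernelIsNil_of_piTorsion (hK : KernelIsNil)
    (hC : NilpotentsArePiTorsion) : PiLocalKernel := by
  intro c hc
  -- square-zero CLASSES are `⟦π⟧`-power torsion in `P`
  have hsq : ∀ y : FormalPeriodRing, y * y = 0 → ∃ N : ℕ, toFormalPeriod (of piRep) ^ N * y = 0 := by
    intro y hy
    obtain ⟨d, rfl⟩ := toFormalPeriod_surjective y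
    rw [← map_mul, toFormalPeriod_eq_zero_iff] at hy
    obtain ⟨N, hN⟩ := hC d hy
    refine ⟨N, ?_⟩
    rw [← toFormalPeriod_iterate_piRep_mul, toFormalPeriod_eq_zero_iff]
    exact hN
  obtain ⟨n, hn⟩ := hK c hc
  obtain ⟨N, hN⟩ := pow_torsion_of_sq_torsion _ hsq n _ hn
  refine ⟨N, ?_⟩
  rw [← toFormalPeriod_eq_zero_iff, toFormalPeriod_iterate_piRep_mul]
  exact hN


end Lattice

/-! ## §10 Targets (cycle 2)

payload `targets = []`, `stuck_stubs = []`. Registered stubs of skeleton `c5e5bca5…` (see §9b):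
nothing broken; no stub statement is refutable by value or by small model from its ledger name and
the triage/card descriptions; exact signatures unavailable to this seat this cycle. When the lead
publishes `Lines/cartier-pullback-nilpotents-are-pi-torsion.lean` (or its STUCK list), the first
attacks are: (i) `stub_cubeCompilation` at boundary-singular germs (`[ (0,1), x^{-1/2} ]`,
`[ (0,1)², (xy)^{-1/2} ]`, `[ (1,∞), x^{-2} ]`: each must be compiled into cube integrals of germs
analytic BEYOND the closed cube — `x = y²`, `x = 1/u` do it; a germ with an essential boundary
singularity after all algebraic substitutions would kill the stub as typed); (ii)
`stub_movesAreStokesModPi` on the simplest non-Stokes move, the coordinate swap / a non-affine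
change of variables of a cube integral, asking for the explicit `g_π`-exponent. -/


/-! ## §11 For the provers: what a proof of the crux must do (cycle 2 summary)

Proved reformulations (all `↔`, this file / `Negative/*`): `IsReduced P` · `nil P = ⊥` ·
`⋂ primes = ⊥` · field points separate · AM–GM rigidity on the cone · non-negative-pair rigidity ·
volume-pair rigidity · `x ^ n = 0 → x = 0` · (with 0540) `IsReduced P[1/π]` (triage
`nilIsPiTorsion_iff_isReduced_away`). A proof must turn a move chain for `[u ⊠ u] ∼ 0` (living in
dimension `2N` and above) into one for `[u] ∼ 0`: a SQUARE-ROOT EXTRACTION on chains. The only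
extraction procedures known to be sound in the calculus are (i) positivity after integration
(`mem_relations_of_mem_cone_of_eval_eq_zero`: works when `u` has a sign — a witness has none,
`witness_changes_sign`), (ii) dimension `0` (`dimZero_kernel`), (iii) slicing a product chain along
a generic algebraic fibre — sound for additivity and Newton–Leibniz in a fibre coordinate, NOT for
coordinate-mixing changes of variables (§8), which is exactly where BCK/polar-type identities such
as `6ζ(2) = π²` live. Hence either a structure theorem for chains through mixing substitutions, or
an external reduced target with controlled kernel (§9b: the picked line; all conjectural weight on
`PiCancellation`), or the summit. Nothing weaker than the crux is known to suffice for the route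
(`route_usage`), but the route only ever applies it to double-shuffle defects in the subring
generated by simplex classes (TRIAGE-r1-2 F2). -/

end Summit.KontsevichZagierPeriods.KontsevichZagierPeriods.Cruxes.ReducedPeriodRing.Disproof
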